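import Literature.Topology.FourManifolds.FlipWall
import Literature.Topology.FourManifolds.PlanarBandFamily
import HarnessLib

/-!
# Cleaning the un-spiked flip frame: a planar track in the band of `b₁` with monotone height

Topic `Literature/Topology/FourManifolds` (trunk T-4MAN). Fact seat
`provefact-Literature.Topology.FourManifolds.Knot.IsConnectedSum.isIsotopic` (Schubert's theorem),
geometric heart for rail knots, closure step for flip frames. For a flip pair `(b₁, b₂)` at the
scales of `FlipWall.lean`, the knot `X°` of the un-spiked flip frame at `u = 0`
(`isNeckFrame_flipBase … (u := 0)`) is, on the **band part** `J = [thi₁ + epsHi/2, tlo₁ + 1 - epsLo/2]`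
of the unrolled parameter, the band image `b₁.band (cleanQ σ)` of an explicit planar track: the
necked upper arch of `b₁` inwards, the **flipped planar deep track** `(1/2, 1/2) - κ deepTrack₂`
of `b₂` (a hairpin north of the crossing centre), the necked lower arch of `b₁` outwards
(`curve_frameKnot_eq_band_cleanQ`); off `J` it is the second summand `B₁` (through `psi₁`).
The heights of this track are not monotone on the two blend zones of the plateau arches, so we
**clean** it: the straight-line-in-height planar family towards the monotone profile `cleanH`
(`= gUp` on the upper edge zone, then down to `1/2 + κ`; the hairpin; `1/2 - κ`, then down to
`gLo` on the lower edge zone) is a planar family in the band (`PlanarBandFamily.lean`), so `X°` is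
isotopic to the **clean knot** `cleanKnot` whose band part is `b₁.band (cleanP 1 σ)` with
nonincreasing height (`isIsotopic_frameKnot_cleanKnot`, `deriv_cleanH_nonpos`).

Everything is proved; no named facts are introduced.

## References

* M. W. Hirsch, *Differential Topology*, Springer GTM 33 (1976), Ch. 8 §1. [HirschDT1976]
-/

open scoped Manifold ContDiff Topology Real
open Function Set Metric Filter

noncomputable section

namespace Literature.Topology.FourManifolds

/-- Local notation: `𝔼 n` is the model Euclidean space `EuclideanSpace ℝ (Fin n)`. -/
local notation "𝔼 " n:arg => EuclideanSpace ℝ (Fin n)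

/-- Local notation: `𝕊 n` is the unit sphere in `EuclideanSpace ℝ (Fin (n + 1))`. -/
local notation "𝕊 " n:arg => (Metric.sphere (0 : EuclideanSpace ℝ (Fin (n + 1))) 1)

attribute [local instance] fact_finrank_euclideanSpace_succ

open KnotsInBall

namespace BandData

/-! ### Rail facts near the second summand -/

section Rails

variable {A B K : Knot} {avoid : Set (𝕊 3)} (b : BandData A B K avoid)

/-- **The height of the upper rail arch is `gUp` up to `thi + 3 epsHi / 2`.** [folklore] -/
theorem railUp_one_eq_gUp {t : ℝ} (ht : t ≤ b.thi + 3 / 2 * b.epsHi) : b.railUp t 1 = b.gUp t := by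
  have h := plateauHeight_of_ge_right (θ₁ := -b.ahi) (θ₂ := -b.thi) (ε := b.epsHi) (y := -(3 / 4 : ℝ))
    (f := fun v ↦ -b.fUp (-v)) (g := fun v ↦ -b.gUp (-v)) b.cUp_hyp.1 b.cUp_hyp.2.1 (θ := -t) (by linarith)
  rw [railUp_apply_one, railUpAux, plateauArch_apply_one, h]
  simp

/-- **The height of the lower rail arch is `gLo` from `tlo - 3 epsLo / 2` on.** [folklore] -/
theorem railLo_one_eq_gLo {t : ℝ} (ht : b.tlo - 3 / 2 * b.epsLo ≤ t) : b.railLo t 1 = b.gLo t := by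
  rw [railLo, plateauArch_apply_one, plateauHeight_of_ge_right b.cLo_hyp.1 b.cLo_hyp.2.1 ht]

/-- `gUp' < 0` up to `thi + 2 epsHi`. [folklore] -/
theorem deriv_gUp_neg {t : ℝ} (ht : t ≤ b.thi + 2 * b.epsHi) : deriv b.gUp t < 0 := by
  have h := b.cUp_hyp.2.2.2 (-t) (by linarith)
  have hd : Differentiable ℝ b.gUp := b.gUp_spec.1.differentiable (by simp)
  have hc : HasDerivAt (fun v ↦ -b.gUp (-v)) (-(deriv b.gUp t * -1)) (-t) := by
    have h1 : HasDerivAt (fun v : ℝ ↦ -v) (-1) (-t) := hasDerivAt_neg _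
    have h2 : HasDerivAt b.gUp (deriv b.gUp t) (-(-t)) := by rw [neg_neg]; exact (hd t).hasDerivAt
    exact (h2.comp (-t) h1).neg
  rw [hc.deriv] at h
  linarith

/-- `gLo' < 0` from `tlo - 2 epsLo` on. [folklore] -/
theorem deriv_gLo_neg {t : ℝ} (ht : b.tlo - 2 * b.epsLo ≤ t) : deriv b.gLo t < 0 := b.cLo_hyp.2.2.2 t ht

/-! ### The monotone target heights -/

/-- **The clean upper height**: `gUp` up to `thi + epsHi`, blended down to the constant `1/2 + w`
over `[thi + epsHi, thi + 2 epsHi]`. [folklore] -/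
def hcUp (w t : ℝ) : ℝ := (1 / 2 + w) + (1 - smoothStep (b.thi + b.epsHi) (b.thi + 2 * b.epsHi) t) * (b.gUp t - (1 / 2 + w))

/-- **The clean lower height**: the constant `1/2 - w` up to `tlo - 2 epsLo`, blended to `gLo` over
`[tlo - 2 epsLo, tlo - epsLo]`. [folklore] -/
def hcLo (w t : ℝ) : ℝ := (1 / 2 - w) + smoothStep (b.tlo - 2 * b.epsLo) (b.tlo - b.epsLo) t * (b.gLo t - (1 / 2 - w))

/-- The clean upper height is `C^∞`. [folklore] -/
theorem contDiff_hcUp (w : ℝ) : ContDiff ℝ ∞ (b.hcUp w) :=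
  contDiff_const.add ((contDiff_const.sub (contDiff_smoothStep _ _)).mul (b.gUp_spec.1.sub contDiff_const))

/-- The clean lower height is `C^∞`. [folklore] -/
theorem contDiff_hcLo (w : ℝ) : ContDiff ℝ ∞ (b.hcLo w) :=
  contDiff_const.add ((contDiff_smoothStep _ _).mul (b.gLo_spec.1.sub contDiff_const))

/-- Up to `thi + epsHi` the clean upper height is `gUp`. [folklore] -/
theorem hcUp_of_le (w : ℝ) {t : ℝ} (ht : t ≤ b.thi + b.epsHi) : b.hcUp w t = b.gUp t := by
  rw [hcUp, smoothStep_of_le (by linarith [b.epsHi_bounds.1]) ht]; ring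

/-- From `thi + 2 epsHi` on the clean upper height is `1/2 + w`. [folklore] -/
theorem hcUp_of_ge (w : ℝ) {t : ℝ} (ht : b.thi + 2 * b.epsHi ≤ t) : b.hcUp w t = 1 / 2 + w := by
  rw [hcUp, smoothStep_of_ge (by linarith [b.epsHi_bounds.1]) ht]; ring

/-- Up to `tlo - 2 epsLo` the clean lower height is `1/2 - w`. [folklore] -/
theorem hcLo_of_le (w : ℝ) {t : ℝ} (ht : t ≤ b.tlo - 2 * b.epsLo) : b.hcLo w t = 1 / 2 - w := by
  rw [hcLo, smoothStep_of_le (by linarith [b.epsLo_bounds.1]) ht]; ring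

/-- From `tlo - epsLo` on the clean lower height is `gLo`. [folklore] -/
theorem hcLo_of_ge (w : ℝ) {t : ℝ} (ht : b.tlo - b.epsLo ≤ t) : b.hcLo w t = b.gLo t := by
  rw [hcLo, smoothStep_of_ge (by linarith [b.epsLo_bounds.1]) ht]; ring

/-- The derivative of the clean upper height. [folklore] -/
theorem hasDerivAt_hcUp (w t : ℝ) :
    HasDerivAt (b.hcUp w) (-(deriv (smoothStep (b.thi + b.epsHi) (b.thi + 2 * b.epsHi)) t) * (b.gUp t - (1 / 2 + w)) +
      (1 - smoothStep (b.thi + b.epsHi) (b.thi + 2 * b.epsHi) t) * deriv b.gUp t) t := by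
  have hS : HasDerivAt (smoothStep (b.thi + b.epsHi) (b.thi + 2 * b.epsHi)) (deriv (smoothStep (b.thi + b.epsHi) (b.thi + 2 * b.epsHi)) t) t :=
    (((contDiff_smoothStep _ _).differentiable (by simp)) t).hasDerivAt
  have hg : HasDerivAt b.gUp (deriv b.gUp t) t := ((b.gUp_spec.1.differentiable (by simp)) t).hasDerivAt
  exact ((hS.const_sub 1).mul (hg.sub_const (1 / 2 + w))).const_add (1 / 2 + w)

/-- The derivative of the clean lower height. [folklore] -/
theorem hasDerivAt_hcLo (w t : ℝ) :
    HasDerivAt (b.hcLo w) (deriv (smoothStep (b.tlo - 2 * b.epsLo) (b.tlo - b.epsLo)) t * (b.gLo t - (1 / 2 - w)) +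
      smoothStep (b.tlo - 2 * b.epsLo) (b.tlo - b.epsLo) t * deriv b.gLo t) t := by
  have hS : HasDerivAt (smoothStep (b.tlo - 2 * b.epsLo) (b.tlo - b.epsLo)) (deriv (smoothStep (b.tlo - 2 * b.epsLo) (b.tlo - b.epsLo)) t) t :=
    (((contDiff_smoothStep _ _).differentiable (by simp)) t).hasDerivAt
  have hg : HasDerivAt b.gLo (deriv b.gLo t) t := ((b.gLo_spec.1.differentiable (by simp)) t).hasDerivAt
  exact (hS.mul (hg.sub_const (1 / 2 - w))).const_add (1 / 2 - w)

/-- **The clean upper height is nonincreasing** (`w ≤ 1/10`), on `[psiInv (thetaB (17/20) + 1), ∞)`.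
[folklore] -/
theorem deriv_hcUp_nonpos {w : ℝ} (hw : w ≤ 10⁻¹) {t : ℝ} (ht : b.psiInv (b.thetaB (17 / 20) + 1) ≤ t) : deriv (b.hcUp w) t ≤ 0 := by
  rw [(b.hasDerivAt_hcUp w t).deriv]
  have hε := b.epsHi_bounds.1
  have hS := smoothStep_mem_Icc (b.thi + b.epsHi) (b.thi + 2 * b.epsHi) t
  have hS' := deriv_smoothStep_nonneg (show b.thi + b.epsHi < b.thi + 2 * b.epsHi by linarith) t
  have hg := b.gUp_mem ht
  rcases le_or_gt t (b.thi + 2 * b.epsHi) with h2 | h2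
  · have hd := b.deriv_gUp_neg h2
    nlinarith [hS.1, hS.2, hg.1]
  · have e1 : smoothStep (b.thi + b.epsHi) (b.thi + 2 * b.epsHi) t = 1 := smoothStep_of_ge (by linarith) h2.le
    have e2 : deriv (smoothStep (b.thi + b.epsHi) (b.thi + 2 * b.epsHi)) t = 0 := by
      have hev : smoothStep (b.thi + b.epsHi) (b.thi + 2 * b.epsHi) =ᶠ[𝓝 t] fun _ ↦ (1 : ℝ) := by
        filter_upwards [Ioi_mem_nhds h2] with s hs using smoothStep_of_ge (by linarith) hs.le
      rw [hev.deriv_eq, deriv_const]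
    rw [e1, e2]; simp

/-- **The clean upper height is strictly decreasing up to `thi + 2 epsHi`** (`w ≤ 1/10`, from
`psiInv (thetaB (17/20) + 1)` on). [folklore] -/
theorem deriv_hcUp_neg {w : ℝ} (hw : w ≤ 10⁻¹) {t : ℝ} (ht : b.psiInv (b.thetaB (17 / 20) + 1) ≤ t) (ht' : t < b.thi + 2 * b.epsHi) :
    deriv (b.hcUp w) t < 0 := by
  rw [(b.hasDerivAt_hcUp w t).deriv]
  have hε := b.epsHi_bounds.1
  have hS := smoothStep_mem_Icc (b.thi + b.epsHi) (b.thi + 2 * b.epsHi) t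
  have hS' := deriv_smoothStep_nonneg (show b.thi + b.epsHi < b.thi + 2 * b.epsHi by linarith) t
  have hg := b.gUp_mem ht
  have hd := b.deriv_gUp_neg ht'.le
  have hS1 : smoothStep (b.thi + b.epsHi) (b.thi + 2 * b.epsHi) t < 1 := by
    rcases le_or_gt t (b.thi + b.epsHi) with h | h
    · rw [smoothStep_of_le (by linarith) h]; exact one_pos
    · exact (smoothStep_mem_Ioo (by linarith) ⟨h, ht'⟩).2
  nlinarith [hS.1, hg.1]

/-- **The clean lower height is nonincreasing** (`w ≤ 1/10`), up to `psiInv (thetaB (3/20))`.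
[folklore] -/
theorem deriv_hcLo_nonpos {w : ℝ} (hw : w ≤ 10⁻¹) {t : ℝ} (ht : t ≤ b.psiInv (b.thetaB (3 / 20))) : deriv (b.hcLo w) t ≤ 0 := by
  rw [(b.hasDerivAt_hcLo w t).deriv]
  have hε := b.epsLo_bounds.1
  have hS := smoothStep_mem_Icc (b.tlo - 2 * b.epsLo) (b.tlo - b.epsLo) t
  have hS' := deriv_smoothStep_nonneg (show b.tlo - 2 * b.epsLo < b.tlo - b.epsLo by linarith) t
  have hg := b.gLo_mem ht
  rcases lt_or_ge t (b.tlo - 2 * b.epsLo) with h2 | h2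
  · have e1 : smoothStep (b.tlo - 2 * b.epsLo) (b.tlo - b.epsLo) t = 0 := smoothStep_of_le (by linarith) h2.le
    have e2 : deriv (smoothStep (b.tlo - 2 * b.epsLo) (b.tlo - b.epsLo)) t = 0 := by
      have hev : smoothStep (b.tlo - 2 * b.epsLo) (b.tlo - b.epsLo) =ᶠ[𝓝 t] fun _ ↦ (0 : ℝ) := by
        filter_upwards [Iio_mem_nhds h2] with s hs using smoothStep_of_le (by linarith) hs.le
      rw [hev.deriv_eq, deriv_const]
    rw [e1, e2]; simp
  · have hd := b.deriv_gLo_neg h2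
    nlinarith [hS.1, hS.2, hg.2]

/-- **The clean lower height is strictly decreasing after `tlo - 2 epsLo`** (`w ≤ 1/10`, up to
`psiInv (thetaB (3/20))`). [folklore] -/
theorem deriv_hcLo_neg {w : ℝ} (hw : w ≤ 10⁻¹) {t : ℝ} (ht : t ≤ b.psiInv (b.thetaB (3 / 20))) (ht' : b.tlo - 2 * b.epsLo < t) :
    deriv (b.hcLo w) t < 0 := by
  rw [(b.hasDerivAt_hcLo w t).deriv]
  have hε := b.epsLo_bounds.1
  have hS := smoothStep_mem_Icc (b.tlo - 2 * b.epsLo) (b.tlo - b.epsLo) t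
  have hS' := deriv_smoothStep_nonneg (show b.tlo - 2 * b.epsLo < b.tlo - b.epsLo by linarith) t
  have hg := b.gLo_mem ht
  have hd := b.deriv_gLo_neg ht'.le
  have hS0 : 0 < smoothStep (b.tlo - 2 * b.epsLo) (b.tlo - b.epsLo) t := by
    rcases lt_or_ge t (b.tlo - b.epsLo) with h | h
    · exact (smoothStep_mem_Ioo (by linarith) ⟨ht', h⟩).1
    · rw [smoothStep_of_ge (by linarith) h]; exact one_pos
  nlinarith [hS.2, hg.2]

/-- Values of the clean upper height: in `[1/2 + w, 9/10)` (`w ≤ 1/10`, from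
`psiInv (thetaB (17/20) + 1)` on). [folklore] -/
theorem hcUp_mem {w : ℝ} (hw : w ≤ 10⁻¹) {t : ℝ} (ht : b.psiInv (b.thetaB (17 / 20) + 1) ≤ t) :
    b.hcUp w t ∈ Ico (1 / 2 + w) (9 / 10 : ℝ) := by
  have hS := smoothStep_mem_Icc (b.thi + b.epsHi) (b.thi + 2 * b.epsHi) t
  have hg := b.gUp_mem ht
  rw [hcUp]
  constructor <;> nlinarith [hS.1, hS.2, hg.1, hg.2]

/-- Values of the clean lower height: in `(1/10, 1/2 - w]` (`w ≤ 1/10`, up to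
`psiInv (thetaB (3/20))`). [folklore] -/
theorem hcLo_mem {w : ℝ} (hw : w ≤ 10⁻¹) {t : ℝ} (ht : t ≤ b.psiInv (b.thetaB (3 / 20))) :
    b.hcLo w t ∈ Ioc (10⁻¹ : ℝ) (1 / 2 - w) := by
  have hS := smoothStep_mem_Icc (b.tlo - 2 * b.epsLo) (b.tlo - b.epsLo) t
  have hg := b.gLo_mem ht
  rw [hcLo]
  constructor <;> nlinarith [hS.1, hS.2, hg.1, hg.2]

end Rails

/-! ### The planar track of the un-spiked flip frame and its cleaning -/

section Flip

variable {A₁ B₁ K₁ : Knot} {b₁ : BandData A₁ B₁ K₁ ∅} {A₂ B₂ K₂ : Knot} {b₂ : BandData A₂ B₂ K₂ ∅}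
  {hcross₁ : b₁.band ⁻¹' sphereEquator 2 ∩ squareNhd b₁.δ = {x ∈ squareNhd b₁.δ | x 0 = 2⁻¹}}
  {hcross₂ : b₂.band ⁻¹' sphereEquator 2 ∩ squareNhd b₂.δ = {x ∈ squareNhd b₂.δ | x 0 = 2⁻¹}}
  {σ₁ ε₁ r₁ A₁' κ ε₂ r₂ : ℝ} (h₁ : b₁.SpikeScale hcross₁ σ₁ ε₁ r₁ A₁' κ) (h₂ : b₂.ArcScale hcross₂ ε₂ r₂ κ)

/-- **The flipped planar deep track** of `b₂`, read in the square of `b₁`: `(1/2, 1/2) - κ deepTrack₂ τ`.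
[folklore] -/
def flipTrack (τ : ℝ) : 𝔼 2 := pt2 2⁻¹ 2⁻¹ - κ • b₂.deepTrack h₁.κ_pos h₂.seven_le_gapLo h₂.seven_le_gapHi τ

/-- **The planar track of the un-spiked flip frame at `u = 0`** on the unrolled band part: the necked
upper arch of `b₁` up to `parHi₁ (-1)`, the flipped deep track through the clamped junction clock up
to `parLo₁ (-1) + 1`, the necked lower arch of `b₁` (shifted by one) after. [folklore] -/
def cleanQ (σ : ℝ) : 𝔼 2 :=
  if σ ≤ b₁.parHi h₁.κ_pos h₁.seven_le_gapHi neg_one_mem then b₁.neckUp κ 1 σ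
  else if σ < b₁.parLo h₁.κ_pos h₁.seven_le_gapLo neg_one_mem + 1 then flipTrack h₁ h₂ (theta h₁ h₂ σ)
  else b₁.neckLo κ 1 (σ - 1)

/-- **The clean height**: the clean upper height up to `tcHi₁`, the height of the track up to
`tcLo₁ + 1`, the clean lower height (shifted by one) after. [folklore] -/
def cleanH (σ : ℝ) : ℝ :=
  if σ ≤ b₁.tcHi then b₁.hcUp κ σ
  else if σ ≤ b₁.tcLo + 1 then cleanQ h₁ h₂ σ 1
  else b₁.hcLo κ (σ - 1)

/-- **The cleaning family**: straight line in the height from the track to the clean height, the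
first coordinate fixed. [folklore] -/
def cleanP (u σ : ℝ) : 𝔼 2 := pt2 (cleanQ h₁ h₂ σ 0) ((1 - u) * cleanQ h₁ h₂ σ 1 + u * cleanH h₁ h₂ σ)

/-! ### Zone formulas -/

/-- The track on the upper zone. [folklore] -/
theorem cleanQ_of_le {σ : ℝ} (hσ : σ ≤ b₁.parHi h₁.κ_pos h₁.seven_le_gapHi neg_one_mem) : cleanQ h₁ h₂ σ = b₁.neckUp κ 1 σ := by
  simp [cleanQ, hσ]

/-- The track on the foreign zone. [folklore] -/
theorem cleanQ_of_mem {σ : ℝ} (hσ : σ ∈ Ioo (b₁.parHi h₁.κ_pos h₁.seven_le_gapHi neg_one_mem) (b₁.parLo h₁.κ_pos h₁.seven_le_gapLo neg_one_mem + 1)) :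
    cleanQ h₁ h₂ σ = flipTrack h₁ h₂ (theta h₁ h₂ σ) := by
  simp [cleanQ, not_le.2 hσ.1, hσ.2]

/-- The track on the lower zone. [folklore] -/
theorem cleanQ_of_ge {σ : ℝ} (hσ : b₁.parLo h₁.κ_pos h₁.seven_le_gapLo neg_one_mem + 1 ≤ σ) : cleanQ h₁ h₂ σ = b₁.neckLo κ 1 (σ - 1) := by
  have h1 : ¬ σ ≤ b₁.parHi h₁.κ_pos h₁.seven_le_gapHi neg_one_mem := by
    have := (b₁.parHi_mem_core h₁.κ_pos h₁.seven_le_gapHi neg_one_mem).2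
    have := (b₁.parLo_mem_core h₁.κ_pos h₁.seven_le_gapLo neg_one_mem).1
    have := b₁.core_marks
    intro h; linarith
  simp [cleanQ, h1, not_lt.2 hσ]

/-- **The flipped track at a lower-core parameter of `b₂` of level `≤ 7/2`.** [folklore] -/
theorem flipTrack_of_alphaLo_le {τ : ℝ} (hc : τ ∈ Icc (b₂.tcLo - b₂.epsLo / 8) (b₂.tcLo + b₂.epsLo / 8)) (hα : b₂.alphaLo κ τ ≤ 7 / 2) :
    flipTrack h₁ h₂ τ = pt2 (2⁻¹ - κ * b₂.alphaLo κ τ) (2⁻¹ + κ) := by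
  rw [flipTrack, b₂.deepTrack_of_alphaLo_le h₁.κ_pos h₂.seven_le_gapLo h₂.seven_le_gapHi hc hα]
  ext i; fin_cases i <;> simp

/-- **The flipped track at an upper-core parameter of `b₂` of level `≤ 7/2`.** [folklore] -/
theorem flipTrack_of_alphaHi_le {τ : ℝ} (hc : τ ∈ Icc (b₂.tcHi - b₂.epsHi / 8) (b₂.tcHi + b₂.epsHi / 8)) (hα : b₂.alphaHi κ τ ≤ 7 / 2) :
    flipTrack h₁ h₂ τ = pt2 (2⁻¹ - κ * b₂.alphaHi κ τ) (2⁻¹ - κ) := by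
  rw [flipTrack, b₂.deepTrack_of_alphaHi_le h₁.κ_pos h₂.seven_le_gapLo h₂.seven_le_gapHi hc hα]
  ext i; fin_cases i <;> simp

/-- The necked upper arch of `b₁` on its closed upper core: `(1/2 + κ αHi₁ σ, 1/2 + κ)`. [folklore] -/
theorem neckUp_core_alpha (hκ : κ ≠ 0) {σ : ℝ} (hc : σ ∈ Icc (b₁.tcHi - b₁.epsHi / 8) (b₁.tcHi + b₁.epsHi / 8)) :
    b₁.neckUp κ 1 σ = pt2 (2⁻¹ + κ * b₁.alphaHi κ σ) (2⁻¹ + κ) := by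
  rw [b₁.neckUp_of_mem_core hc, b₁.mul_alphaHi hκ, chiHi]
  ext i; fin_cases i <;> simp

/-- The necked lower arch of `b₁` on its closed lower core: `(1/2 + κ αLo₁ σ, 1/2 - κ)`. [folklore] -/
theorem neckLo_core_alpha (hκ : κ ≠ 0) {σ : ℝ} (hc : σ ∈ Icc (b₁.tcLo - b₁.epsLo / 8) (b₁.tcLo + b₁.epsLo / 8)) :
    b₁.neckLo κ 1 σ = pt2 (2⁻¹ + κ * b₁.alphaLo κ σ) (2⁻¹ - κ) := by
  rw [b₁.neckLo_of_mem_core hc, b₁.mul_alphaLo hκ, chiLo]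
  ext i; fin_cases i <;> simp

/-- **Upper junction of the track**: on `[parHi₁ (-3/4), parHi₁ (-5/4)]` the necked upper arch is the
flipped track through `Θ`. [folklore] -/
theorem neckUp_eq_flipTrack_theta {σ : ℝ}
    (hσ : σ ∈ Icc (b₁.parHi h₁.κ_pos h₁.seven_le_gapHi neg_three_quarters_mem) (b₁.parHi h₁.κ_pos h₁.seven_le_gapHi neg_five_quarters_mem)) :
    b₁.neckUp κ 1 σ = flipTrack h₁ h₂ (theta h₁ h₂ σ) := by
  have hκ := h₁.κ_pos
  have h7₁' := h₁.seven_le_gapHi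
  have hlo : b₁.parHi hκ h7₁' neg_half_mem ≤ σ := le_trans (b₁.parHi_le_parHi hκ h7₁' neg_three_quarters_mem neg_half_mem (by norm_num)) hσ.1
  have hhi : σ ≤ b₁.parHi hκ h7₁' neg_five_mem := le_trans hσ.2 (b₁.parHi_le_parHi hκ h7₁' neg_five_mem neg_five_quarters_mem (by norm_num))
  have hcore : σ ∈ Icc (b₁.tcHi - b₁.epsHi / 8) (b₁.tcHi + b₁.epsHi / 8) :=
    ⟨le_trans (b₁.parHi_mem_core hκ h7₁' neg_half_mem).1 hlo, le_trans hhi (b₁.parHi_mem_core hκ h7₁' neg_five_mem).2⟩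
  have hα2 : -(5 / 4) ≤ b₁.alphaHi κ σ := (b₁.le_alphaHi_iff' hκ h7₁' neg_five_quarters_mem hcore).2 hσ.2
  have hθ : theta h₁ h₂ σ = jc h₁ h₂ σ := theta_eq h₁ h₂ ⟨hσ.1, by
    have h1 := (b₁.parHi_mem_core hκ h7₁' neg_five_quarters_mem).2
    have h2 := (b₁.parLo_mem_core hκ h₁.seven_le_gapLo neg_three_quarters_mem).1
    have := b₁.core_marks; linarith [hσ.2]⟩
  obtain ⟨hc₂, hlev⟩ := junctionClock_lo b₁ b₂ hκ h₁.seven_le_gapLo h7₁' h₂.seven_le_gapLo h₂.seven_le_gapHi ⟨hlo, hhi⟩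
  rw [hθ, jc, flipTrack_of_alphaLo_le h₁ h₂ hc₂ (by rw [hlev]; linarith), hlev, neckUp_core_alpha h₁.κ_pos.ne' hcore]
  congr 1; ring

/-- **Lower junction of the track**: on `[parLo₁ (-7/2) + 1, parLo₁ (-3/4) + 1]` the shifted necked
lower arch is the flipped track through `Θ`. [folklore] -/
theorem neckLo_eq_flipTrack_theta {σ : ℝ}
    (hσ : σ ∈ Icc (b₁.parLo h₁.κ_pos h₁.seven_le_gapLo neg_seven_halves_mem + 1) (b₁.parLo h₁.κ_pos h₁.seven_le_gapLo neg_three_quarters_mem + 1)) :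
    b₁.neckLo κ 1 (σ - 1) = flipTrack h₁ h₂ (theta h₁ h₂ σ) := by
  have hκ := h₁.κ_pos
  have h7₁ := h₁.seven_le_gapLo
  have hlo : b₁.parLo hκ h7₁ neg_five_mem ≤ σ - 1 := by
    linarith [b₁.parLo_le_parLo hκ h7₁ neg_five_mem neg_seven_halves_mem (by norm_num), hσ.1]
  have hhi : σ - 1 ≤ b₁.parLo hκ h7₁ neg_half_mem := by
    linarith [hσ.2, b₁.parLo_le_parLo hκ h7₁ neg_three_quarters_mem neg_half_mem (by norm_num)]
  have hcore : σ - 1 ∈ Icc (b₁.tcLo - b₁.epsLo / 8) (b₁.tcLo + b₁.epsLo / 8) :=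
    ⟨le_trans (b₁.parLo_mem_core hκ h7₁ neg_five_mem).1 hlo, le_trans hhi (b₁.parLo_mem_core hκ h7₁ neg_half_mem).2⟩
  have hα2 : -(7 / 2) ≤ b₁.alphaLo κ (σ - 1) := (b₁.le_alphaLo_iff' hκ h7₁ neg_seven_halves_mem hcore).2 (by linarith [hσ.1])
  have hθ : theta h₁ h₂ σ = jc h₁ h₂ σ := theta_eq h₁ h₂ ⟨by
    have h1 := (b₁.parHi_mem_core hκ h₁.seven_le_gapHi neg_three_quarters_mem).2
    have h2 := (b₁.parLo_mem_core hκ h7₁ neg_seven_halves_mem).1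
    have := b₁.core_marks; linarith [hσ.1], hσ.2⟩
  obtain ⟨hc₂, hlev⟩ := junctionClock_hi b₁ b₂ hκ h7₁ h₁.seven_le_gapHi h₂.seven_le_gapLo h₂.seven_le_gapHi (t := σ) ⟨by linarith, by linarith⟩
  rw [hθ, jc, flipTrack_of_alphaHi_le h₁ h₂ hc₂ (by rw [hlev]; linarith), hlev, neckLo_core_alpha h₁.κ_pos.ne' hcore]
  congr 1; ring

/-- **The track is the necked upper arch on the extended upper zone** `(-∞, parHi₁ (-5/4)]`… more
precisely on `[parHi₁ (-3/4), parHi₁ (-5/4)]` both formulas agree, so `cleanQ = neckUp` up to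
`parHi₁ (-5/4)`. [folklore] -/
theorem cleanQ_eq_neckUp {σ : ℝ} (hσ : σ ≤ b₁.parHi h₁.κ_pos h₁.seven_le_gapHi neg_five_quarters_mem) : cleanQ h₁ h₂ σ = b₁.neckUp κ 1 σ := by
  have hκ := h₁.κ_pos
  rcases le_or_gt σ (b₁.parHi hκ h₁.seven_le_gapHi neg_one_mem) with h | h
  · exact cleanQ_of_le h₁ h₂ h
  · have h2 : σ < b₁.parLo hκ h₁.seven_le_gapLo neg_one_mem + 1 := by
      have := (b₁.parHi_mem_core hκ h₁.seven_le_gapHi neg_five_quarters_mem).2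
      have := (b₁.parLo_mem_core hκ h₁.seven_le_gapLo neg_one_mem).1
      have := b₁.core_marks; linarith
    rw [cleanQ_of_mem h₁ h₂ ⟨h, h2⟩]
    exact (neckUp_eq_flipTrack_theta h₁ h₂ ⟨(b₁.parHi_le_parHi hκ h₁.seven_le_gapHi neg_one_mem neg_three_quarters_mem (by norm_num)).trans h.le, hσ⟩).symm

/-- **The track is the shifted necked lower arch from `parLo₁ (-7/2) + 1` on.** [folklore] -/
theorem cleanQ_eq_neckLo {σ : ℝ} (hσ : b₁.parLo h₁.κ_pos h₁.seven_le_gapLo neg_seven_halves_mem + 1 ≤ σ) : cleanQ h₁ h₂ σ = b₁.neckLo κ 1 (σ - 1) := by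
  have hκ := h₁.κ_pos
  rcases le_or_gt (b₁.parLo hκ h₁.seven_le_gapLo neg_one_mem + 1) σ with h | h
  · exact cleanQ_of_ge h₁ h₂ h
  · have h2 : b₁.parHi hκ h₁.seven_le_gapHi neg_one_mem < σ := by
      have := (b₁.parHi_mem_core hκ h₁.seven_le_gapHi neg_one_mem).2
      have := (b₁.parLo_mem_core hκ h₁.seven_le_gapLo neg_seven_halves_mem).1
      have := b₁.core_marks; linarith
    rw [cleanQ_of_mem h₁ h₂ ⟨h2, h⟩]
    exact (neckLo_eq_flipTrack_theta h₁ h₂ ⟨hσ, by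
      linarith [b₁.parLo_le_parLo hκ h₁.seven_le_gapLo neg_one_mem neg_three_quarters_mem (by norm_num)]⟩).symm

/-- **The track is the flipped track through `Θ` on the extended foreign zone**
`[parHi₁ (-3/4), parLo₁ (-3/4) + 1]`. [folklore] -/
theorem cleanQ_eq_flipTrack {σ : ℝ}
    (hσ : σ ∈ Icc (b₁.parHi h₁.κ_pos h₁.seven_le_gapHi neg_three_quarters_mem) (b₁.parLo h₁.κ_pos h₁.seven_le_gapLo neg_three_quarters_mem + 1)) :
    cleanQ h₁ h₂ σ = flipTrack h₁ h₂ (theta h₁ h₂ σ) := by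
  have hκ := h₁.κ_pos
  rcases le_or_gt σ (b₁.parHi hκ h₁.seven_le_gapHi neg_one_mem) with h | h
  · rw [cleanQ_of_le h₁ h₂ h]
    exact neckUp_eq_flipTrack_theta h₁ h₂ ⟨hσ.1, h.trans (b₁.parHi_le_parHi hκ h₁.seven_le_gapHi neg_five_quarters_mem neg_one_mem (by norm_num))⟩
  rcases lt_or_ge σ (b₁.parLo hκ h₁.seven_le_gapLo neg_one_mem + 1) with h2 | h2
  · exact cleanQ_of_mem h₁ h₂ ⟨h, h2⟩
  · rw [cleanQ_of_ge h₁ h₂ h2]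
    exact neckLo_eq_flipTrack_theta h₁ h₂ ⟨by
      linarith [b₁.parLo_le_parLo hκ h₁.seven_le_gapLo neg_seven_halves_mem neg_one_mem (by norm_num)], hσ.2⟩

/-! ### Smoothness of the track, the clean height and the family -/

/-- The flipped track through `Θ` is `C^∞`. [folklore] -/
theorem contDiff_flipTrack_theta : ContDiff ℝ ∞ fun σ ↦ flipTrack h₁ h₂ (theta h₁ h₂ σ) :=
  contDiff_const.sub (((b₂.contDiff_deepTrack h₁.κ_pos h₂.seven_le_gapLo h₂.seven_le_gapHi).comp (contDiff_theta h₁ h₂)).const_smul κ)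

/-- **The track is `C^∞`.** [folklore] -/
theorem contDiff_cleanQ : ContDiff ℝ ∞ (cleanQ h₁ h₂) := by
  have hκ := h₁.κ_pos
  obtain ⟨m1, m2⟩ := zone_marks h₁
  have z1 : b₁.parHi hκ h₁.seven_le_gapHi neg_three_quarters_mem < b₁.parHi hκ h₁.seven_le_gapHi neg_one_mem :=
    b₁.parHi_lt_parHi hκ h₁.seven_le_gapHi neg_one_mem neg_three_quarters_mem (by norm_num)
  have z2 : b₁.parLo hκ h₁.seven_le_gapLo neg_one_mem < b₁.parLo hκ h₁.seven_le_gapLo neg_three_quarters_mem :=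
    b₁.parLo_lt_parLo hκ h₁.seven_le_gapLo neg_one_mem neg_three_quarters_mem (by norm_num)
  have hU : ContDiff ℝ ∞ (b₁.neckUp κ 1) := b₁.contDiff_neckUp_stage κ 1
  have hL : ContDiff ℝ ∞ fun σ ↦ b₁.neckLo κ 1 (σ - 1) := (b₁.contDiff_neckLo_stage κ 1).comp (contDiff_id.sub contDiff_const)
  have hF := contDiff_flipTrack_theta h₁ h₂
  rw [contDiff_iff_contDiffAt]
  intro σ
  rcases lt_or_ge σ (b₁.parHi hκ h₁.seven_le_gapHi neg_five_quarters_mem) with hs1 | hs1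
  · have hev : cleanQ h₁ h₂ =ᶠ[𝓝 σ] b₁.neckUp κ 1 := by
      filter_upwards [Iio_mem_nhds hs1] with s hs using cleanQ_eq_neckUp h₁ h₂ hs.le
    exact hU.contDiffAt.congr_of_eventuallyEq hev
  rcases le_or_gt σ (b₁.parLo hκ h₁.seven_le_gapLo neg_seven_halves_mem + 1) with hs2 | hs2
  · have hev : cleanQ h₁ h₂ =ᶠ[𝓝 σ] fun σ ↦ flipTrack h₁ h₂ (theta h₁ h₂ σ) := by
      filter_upwards [Ioo_mem_nhds (show b₁.parHi hκ h₁.seven_le_gapHi neg_three_quarters_mem < σ by linarith)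
        (show σ < b₁.parLo hκ h₁.seven_le_gapLo neg_three_quarters_mem + 1 by linarith)] with s hs
        using cleanQ_eq_flipTrack h₁ h₂ (Ioo_subset_Icc_self hs)
    exact hF.contDiffAt.congr_of_eventuallyEq hev
  · have hev : cleanQ h₁ h₂ =ᶠ[𝓝 σ] fun σ ↦ b₁.neckLo κ 1 (σ - 1) := by
      filter_upwards [Ioi_mem_nhds hs2] with s hs using cleanQ_eq_neckLo h₁ h₂ hs.le
    exact hL.contDiffAt.congr_of_eventuallyEq hev

/-- **Height of the track on the upper core**: `1/2 + κ` on `[tcHi₁ - epsHi/8, parHi₁ (-5/4)]`.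
[folklore] -/
theorem cleanQ_one_of_upperCore {σ : ℝ} (hσ : σ ∈ Icc (b₁.tcHi - b₁.epsHi / 8) (b₁.parHi h₁.κ_pos h₁.seven_le_gapHi neg_five_quarters_mem)) :
    cleanQ h₁ h₂ σ 1 = 2⁻¹ + κ := by
  rw [cleanQ_eq_neckUp h₁ h₂ hσ.2, neckUp_core_alpha h₁.κ_pos.ne' ⟨hσ.1, hσ.2.trans (b₁.parHi_mem_core h₁.κ_pos h₁.seven_le_gapHi neg_five_quarters_mem).2⟩]
  rfl

/-- **Height of the track on the shifted lower core**: `1/2 - κ` on `[parLo₁ (-7/2) + 1, tcLo₁ + epsLo/8 + 1]`.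
[folklore] -/
theorem cleanQ_one_of_lowerCore {σ : ℝ} (hσ : σ ∈ Icc (b₁.parLo h₁.κ_pos h₁.seven_le_gapLo neg_seven_halves_mem + 1) (b₁.tcLo + b₁.epsLo / 8 + 1)) :
    cleanQ h₁ h₂ σ 1 = 2⁻¹ - κ := by
  rw [cleanQ_eq_neckLo h₁ h₂ hσ.1, neckLo_core_alpha h₁.κ_pos.ne' ⟨by linarith [hσ.1, (b₁.parLo_mem_core h₁.κ_pos h₁.seven_le_gapLo neg_seven_halves_mem).1],
    by linarith [hσ.2]⟩]
  rfl

/-- The clean height on the first zone. [folklore] -/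
theorem cleanH_of_le {σ : ℝ} (hσ : σ ≤ b₁.tcHi) : cleanH h₁ h₂ σ = b₁.hcUp κ σ := by simp [cleanH, hσ]

/-- The clean height on the middle zone. [folklore] -/
theorem cleanH_of_mem {σ : ℝ} (hσ : σ ∈ Ioc b₁.tcHi (b₁.tcLo + 1)) : cleanH h₁ h₂ σ = cleanQ h₁ h₂ σ 1 := by
  simp [cleanH, not_le.2 hσ.1, hσ.2]

/-- The clean height on the last zone. [folklore] -/
theorem cleanH_of_gt {σ : ℝ} (hσ : b₁.tcLo + 1 < σ) : cleanH h₁ h₂ σ = b₁.hcLo κ (σ - 1) := by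
  have : ¬ σ ≤ b₁.tcHi := by have := b₁.core_marks; have := b₁.epsLo_bounds.1; have := b₁.epsHi_bounds.1; intro h; linarith
  simp [cleanH, this, not_le.2 hσ]

/-- **First junction of the clean height**: on the upper core `[tcHi₁ - epsHi/8, parHi₁ (-5/4)]` the
clean height is `1/2 + κ`, as is the height of the track. [folklore] -/
theorem cleanH_eq_of_upperCore {σ : ℝ} (hσ : σ ∈ Icc (b₁.tcHi - b₁.epsHi / 8) (b₁.parHi h₁.κ_pos h₁.seven_le_gapHi neg_five_quarters_mem)) :
    cleanH h₁ h₂ σ = 2⁻¹ + κ := by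
  have hw := b₁.tcHi_window
  have hε := b₁.epsLo_bounds.1
  rcases le_or_gt σ b₁.tcHi with h | h
  · rw [cleanH_of_le h₁ h₂ h, b₁.hcUp_of_ge κ (by linarith [hσ.1])]; norm_num
  · rw [cleanH_of_mem h₁ h₂ ⟨h, by
      have := (b₁.parHi_mem_core h₁.κ_pos h₁.seven_le_gapHi neg_five_quarters_mem).2
      have := b₁.core_marks; linarith [hσ.2]⟩, cleanQ_one_of_upperCore h₁ h₂ hσ]

/-- **Second junction of the clean height**: on `[parLo₁ (-7/2) + 1, tcLo₁ + epsLo/8 + 1]` the clean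
height is `1/2 - κ`, as is the height of the track. [folklore] -/
theorem cleanH_eq_of_lowerCore {σ : ℝ} (hσ : σ ∈ Icc (b₁.parLo h₁.κ_pos h₁.seven_le_gapLo neg_seven_halves_mem + 1) (b₁.tcLo + b₁.epsLo / 8 + 1)) :
    cleanH h₁ h₂ σ = 2⁻¹ - κ := by
  have hw := b₁.tcLo_window
  have hcm := b₁.core_marks
  have hε' := b₁.epsHi_bounds.1
  have h0 := (b₁.parLo_mem_core h₁.κ_pos h₁.seven_le_gapLo neg_seven_halves_mem).1
  rcases le_or_gt σ (b₁.tcLo + 1) with h | h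
  · rw [cleanH_of_mem h₁ h₂ ⟨by linarith [hσ.1], h⟩, cleanQ_one_of_lowerCore h₁ h₂ hσ]
  · rw [cleanH_of_gt h₁ h₂ h, b₁.hcLo_of_le κ (by linarith [hσ.2])]; norm_num

/-- The clean height is the constant `1/2 + κ` on `[thi₁ + 2 epsHi, parHi₁ (-5/4)]`. [folklore] -/
theorem cleanH_eq_const_up {σ : ℝ} (hσ : σ ∈ Icc (b₁.thi + 2 * b₁.epsHi) (b₁.parHi h₁.κ_pos h₁.seven_le_gapHi neg_five_quarters_mem)) :
    cleanH h₁ h₂ σ = 2⁻¹ + κ := by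
  have hw := b₁.tcHi_window
  rcases le_or_gt σ b₁.tcHi with h | h
  · rw [cleanH_of_le h₁ h₂ h, b₁.hcUp_of_ge κ hσ.1]; norm_num
  · exact cleanH_eq_of_upperCore h₁ h₂ ⟨by linarith [hw.2.2], hσ.2⟩

/-- The clean height is the constant `1/2 - κ` on `[parLo₁ (-7/2) + 1, tlo₁ + 1 - 2 epsLo]`. [folklore] -/
theorem cleanH_eq_const_lo {σ : ℝ} (hσ : σ ∈ Icc (b₁.parLo h₁.κ_pos h₁.seven_le_gapLo neg_seven_halves_mem + 1) (b₁.tlo + 1 - 2 * b₁.epsLo)) :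
    cleanH h₁ h₂ σ = 2⁻¹ - κ := by
  have hw := b₁.tcLo_window
  rcases le_or_gt σ (b₁.tcLo + 1) with h | h
  · exact cleanH_eq_of_lowerCore h₁ h₂ ⟨hσ.1, by linarith [hw.2.2]⟩
  · rw [cleanH_of_gt h₁ h₂ h, b₁.hcLo_of_le κ (by linarith [hσ.2])]; norm_num

/-- **The clean height is `C^∞`.** [folklore] -/
theorem contDiff_cleanH : ContDiff ℝ ∞ (cleanH h₁ h₂) := by
  have hκ := h₁.κ_pos
  have hw := b₁.tcHi_window
  have hw' := b₁.tcLo_window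
  have hcm := b₁.core_marks
  have hε := b₁.epsLo_bounds.1
  have hε' := b₁.epsHi_bounds.1
  have hQ1 : ContDiff ℝ ∞ fun σ ↦ cleanQ h₁ h₂ σ 1 := contDiff_euclidean.1 (contDiff_cleanQ h₁ h₂) 1
  have hL : ContDiff ℝ ∞ fun σ ↦ b₁.hcLo κ (σ - 1) := (b₁.contDiff_hcLo κ).comp (contDiff_id.sub contDiff_const)
  have p1 : b₁.tcHi < b₁.parHi hκ h₁.seven_le_gapHi neg_five_quarters_mem := by
    rw [← b₁.parHi_zero hκ h₁.seven_le_gapHi]; exact b₁.parHi_lt_parHi hκ h₁.seven_le_gapHi neg_five_quarters_mem _ (by norm_num)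
  have p2 : b₁.parLo hκ h₁.seven_le_gapLo neg_seven_halves_mem < b₁.tcLo := by
    rw [← b₁.parLo_zero hκ h₁.seven_le_gapLo]; exact b₁.parLo_lt_parLo hκ h₁.seven_le_gapLo neg_seven_halves_mem _ (by norm_num)
  rw [contDiff_iff_contDiffAt]
  intro σ
  rcases lt_or_ge σ (b₁.tcHi - b₁.epsHi / 8) with hs1 | hs1
  · have hev : cleanH h₁ h₂ =ᶠ[𝓝 σ] b₁.hcUp κ := by
      filter_upwards [Iio_mem_nhds hs1] with s hs using cleanH_of_le h₁ h₂ (by have := mem_Iio.1 hs; linarith)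
    exact (b₁.contDiff_hcUp κ).contDiffAt.congr_of_eventuallyEq hev
  rcases le_or_gt σ b₁.tcHi with hs2 | hs2
  · have hev : cleanH h₁ h₂ =ᶠ[𝓝 σ] fun _ ↦ 2⁻¹ + κ := by
      filter_upwards [Ioo_mem_nhds (show b₁.thi + 2 * b₁.epsHi < σ by linarith) (show σ < b₁.parHi hκ h₁.seven_le_gapHi neg_five_quarters_mem by linarith)]
        with s hs using cleanH_eq_const_up h₁ h₂ (Ioo_subset_Icc_self hs)
    exact contDiffAt_const.congr_of_eventuallyEq hev
  rcases lt_or_ge σ (b₁.tcLo + 1) with hs3 | hs3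
  · have hev : cleanH h₁ h₂ =ᶠ[𝓝 σ] fun σ ↦ cleanQ h₁ h₂ σ 1 := by
      filter_upwards [Ioo_mem_nhds hs2 hs3] with s hs using cleanH_of_mem h₁ h₂ ⟨hs.1, hs.2.le⟩
    exact hQ1.contDiffAt.congr_of_eventuallyEq hev
  rcases le_or_gt σ (b₁.tcLo + b₁.epsLo / 8 + 1) with hs4 | hs4
  · have hev : cleanH h₁ h₂ =ᶠ[𝓝 σ] fun _ ↦ 2⁻¹ - κ := by
      filter_upwards [Ioo_mem_nhds (show b₁.parLo hκ h₁.seven_le_gapLo neg_seven_halves_mem + 1 < σ by linarith)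
        (show σ < b₁.tlo + 1 - 2 * b₁.epsLo by linarith)] with s hs using cleanH_eq_const_lo h₁ h₂ (Ioo_subset_Icc_self hs)
    exact contDiffAt_const.congr_of_eventuallyEq hev
  · have hev : cleanH h₁ h₂ =ᶠ[𝓝 σ] fun σ ↦ b₁.hcLo κ (σ - 1) := by
      filter_upwards [Ioi_mem_nhds (show b₁.tcLo + 1 < σ by linarith)] with s hs using cleanH_of_gt h₁ h₂ hs
    exact hL.contDiffAt.congr_of_eventuallyEq hev

/-- **The cleaning family is jointly `C^∞`.** [folklore] -/
theorem contDiff_cleanP : ContDiff ℝ ∞ (uncurry (cleanP h₁ h₂)) := by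
  have hQ := contDiff_cleanQ h₁ h₂
  have h0 : ContDiff ℝ ∞ fun q : ℝ × ℝ ↦ cleanQ h₁ h₂ q.2 0 := (contDiff_euclidean.1 hQ 0).comp contDiff_snd
  have h1 : ContDiff ℝ ∞ fun q : ℝ × ℝ ↦ cleanQ h₁ h₂ q.2 1 := (contDiff_euclidean.1 hQ 1).comp contDiff_snd
  have hH : ContDiff ℝ ∞ fun q : ℝ × ℝ ↦ cleanH h₁ h₂ q.2 := (contDiff_cleanH h₁ h₂).comp contDiff_snd
  have hc1 : ContDiff ℝ ∞ fun q : ℝ × ℝ ↦ (1 - q.1) * cleanQ h₁ h₂ q.2 1 + q.1 * cleanH h₁ h₂ q.2 :=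
    ((contDiff_const.sub contDiff_fst).mul h1).add (contDiff_fst.mul hH)
  rw [contDiff_euclidean]
  intro i; fin_cases i
  · exact h0
  · exact hc1

/-- First coordinate of the family: that of the track. [folklore] -/
@[simp] theorem cleanP_apply_zero (u σ : ℝ) : cleanP h₁ h₂ u σ 0 = cleanQ h₁ h₂ σ 0 := rfl

/-- Second coordinate of the family. [folklore] -/
@[simp] theorem cleanP_apply_one (u σ : ℝ) : cleanP h₁ h₂ u σ 1 = (1 - u) * cleanQ h₁ h₂ σ 1 + u * cleanH h₁ h₂ σ := rfl

/-- At `u = 0` the family is the track. [folklore] -/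
theorem cleanP_zero (σ : ℝ) : cleanP h₁ h₂ 0 σ = cleanQ h₁ h₂ σ := by
  ext i; fin_cases i <;> simp

/-- Where the clean height is the height of the track nothing moves. [folklore] -/
theorem cleanP_eq_of_eq {σ : ℝ} (h : cleanH h₁ h₂ σ = cleanQ h₁ h₂ σ 1) (u : ℝ) : cleanP h₁ h₂ u σ = cleanQ h₁ h₂ σ := by
  ext i; fin_cases i
  · simp
  · simp [h]; ring

/-- **Up to the end of the upper edge zone nothing moves**: `cleanH σ = cleanQ σ 1 = gUp σ` for
`σ ≤ thi₁ + epsHi`. [folklore] -/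
theorem cleanH_eq_of_le_edge {σ : ℝ} (hσ : σ ≤ b₁.thi + b₁.epsHi) : cleanH h₁ h₂ σ = cleanQ h₁ h₂ σ 1 ∧ cleanQ h₁ h₂ σ 1 = b₁.gUp σ := by
  have hw := b₁.tcHi_window
  have hε := b₁.epsHi_bounds.1
  have hcm := b₁.core_marks
  have hz : σ ≤ b₁.parHi h₁.κ_pos h₁.seven_le_gapHi neg_five_quarters_mem := by
    have := (b₁.parHi_mem_core h₁.κ_pos h₁.seven_le_gapHi neg_five_quarters_mem).1; linarith
  have hQ : cleanQ h₁ h₂ σ 1 = b₁.gUp σ := by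
    rw [cleanQ_eq_neckUp h₁ h₂ hz, b₁.neckUp_eq_railUp (fun hm ↦ by linarith [hm.1]), b₁.railUp_one_eq_gUp (by linarith)]
  refine ⟨?_, hQ⟩
  rw [cleanH_of_le h₁ h₂ (by linarith), b₁.hcUp_of_le κ hσ, hQ]

/-- **From the start of the shifted lower edge zone on nothing moves**: `cleanH σ = cleanQ σ 1 = gLo (σ - 1)`
for `tlo₁ + 1 - epsLo ≤ σ`. [folklore] -/
theorem cleanH_eq_of_ge_edge {σ : ℝ} (hσ : b₁.tlo + 1 - b₁.epsLo ≤ σ) : cleanH h₁ h₂ σ = cleanQ h₁ h₂ σ 1 ∧ cleanQ h₁ h₂ σ 1 = b₁.gLo (σ - 1) := by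
  have hw := b₁.tcLo_window
  have hε := b₁.epsLo_bounds.1
  have hcm := b₁.core_marks
  have hz : b₁.parLo h₁.κ_pos h₁.seven_le_gapLo neg_seven_halves_mem + 1 ≤ σ := by
    have := (b₁.parLo_mem_core h₁.κ_pos h₁.seven_le_gapLo neg_seven_halves_mem).2; linarith
  have hQ : cleanQ h₁ h₂ σ 1 = b₁.gLo (σ - 1) := by
    rw [cleanQ_eq_neckLo h₁ h₂ hz, b₁.neckLo_eq_railLo (fun hm ↦ by linarith [hm.2]), b₁.railLo_one_eq_gLo (by linarith)]
  refine ⟨?_, hQ⟩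
  rw [cleanH_of_gt h₁ h₂ (by linarith), b₁.hcLo_of_ge κ (by linarith), hQ]

/-- **Off `(thi₁ + epsHi, tlo₁ + 1 - epsLo)` the cleaning family does not move.** [folklore] -/
theorem cleanP_eq_of_not_mem (u : ℝ) {σ : ℝ} (hσ : σ ∉ Ioo (b₁.thi + b₁.epsHi) (b₁.tlo + 1 - b₁.epsLo)) :
    cleanP h₁ h₂ u σ = cleanP h₁ h₂ 0 σ := by
  rw [cleanP_zero]
  rcases not_and_or.1 (fun h ↦ hσ h) with h | h
  · exact cleanP_eq_of_eq h₁ h₂ (cleanH_eq_of_le_edge h₁ h₂ (not_lt.1 h)).1 u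
  · exact cleanP_eq_of_eq h₁ h₂ (cleanH_eq_of_ge_edge h₁ h₂ (not_lt.1 h)).1 u

/-! ### Coordinates of the deep track on the range of `Θ` -/

/-- **First coordinate of the planar deep track of `b₂` on `[parLo₂ v, parHi₂ v]`, `0 ≤ v ≤ 1`**: in
`[min v 4 … ]`, precisely `v ≤ X ≤ 5` (levels between `v` and `5`, turns capped at `4 ≤ X ≤ a`).
[folklore] -/
theorem deepTrack_zero_mem {v : ℝ} (hv : v ∈ Icc (0 : ℝ) 1) {τ : ℝ}
    (hτ : τ ∈ Icc (b₂.parLo h₁.κ_pos h₂.seven_le_gapLo (mem7_of_mem01 hv)) (b₂.parHi h₁.κ_pos h₂.seven_le_gapHi (mem7_of_mem01 hv))) :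
    b₂.deepTrack h₁.κ_pos h₂.seven_le_gapLo h₂.seven_le_gapHi τ 0 ∈ Icc v 5 := by
  have hκ := h₁.κ_pos
  have h7 := h₂.seven_le_gapLo
  have h7' := h₂.seven_le_gapHi
  have hv7 := mem7_of_mem01 hv
  rcases le_or_gt τ (b₂.parLo hκ h7 five_mem) with h5 | h5
  · have hc := b₂.mem_coreLo_of_zone hκ h7 ⟨(b₂.parLo_le_parLo hκ h7 neg_seven_mem hv7 (by linarith [hv.1])).trans hτ.1, h5⟩
    have ha1 : v ≤ b₂.alphaLo κ τ := (b₂.le_alphaLo_iff' hκ h7 hv7 hc).2 hτ.1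
    have ha5 : b₂.alphaLo κ τ ≤ 5 := (b₂.alphaLo_le_iff' hκ h7 five_mem hc).2 h5
    rw [b₂.deepTrack_of_le hκ h7 h7' h5, lowerTurn_apply_zero]
    refine ⟨?_, turnX_le_five ha5⟩
    rcases le_or_gt (b₂.alphaLo κ τ) 4 with h4 | h4
    · exact ha1.trans (turnX_mem_of_le h4).1
    · linarith [(turnX_le_of_ge h4.le).1, hv.2]
  rcases lt_or_ge τ (b₂.parHi hκ h7' five_mem) with h5' | h5'
  · rw [b₂.deepTrack_of_mem hκ h7 h7' ⟨h5, h5'⟩, pt2_apply_zero]; exact ⟨by linarith [hv.2], by norm_num⟩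
  · have hc := b₂.mem_coreHi_of_zone hκ h7' ⟨h5', hτ.2.trans (b₂.parHi_le_parHi hκ h7' neg_seven_mem hv7 (by linarith [hv.1]))⟩
    have ha1 : v ≤ b₂.alphaHi κ τ := (b₂.le_alphaHi_iff' hκ h7' hv7 hc).2 hτ.2
    have ha5 : b₂.alphaHi κ τ ≤ 5 := (b₂.alphaHi_le_iff' hκ h7' five_mem hc).2 h5'
    rw [b₂.deepTrack_of_ge hκ h7 h7' h5', upperTurn_apply_zero]
    refine ⟨?_, turnX_le_five ha5⟩
    rcases le_or_gt (b₂.alphaHi κ τ) 4 with h4 | h4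
    · exact ha1.trans (turnX_mem_of_le h4).1
    · linarith [(turnX_le_of_ge h4.le).1, hv.2]

/-- **Second coordinate of the planar deep track of `b₂`** on `[parLo₂ (-7), parHi₂ (-7)]`: in `[-1, 1]`.
[folklore] -/
theorem abs_deepTrack_one_le {τ : ℝ}
    (hτ : τ ∈ Icc (b₂.parLo h₁.κ_pos h₂.seven_le_gapLo neg_seven_mem) (b₂.parHi h₁.κ_pos h₂.seven_le_gapHi neg_seven_mem)) :
    |b₂.deepTrack h₁.κ_pos h₂.seven_le_gapLo h₂.seven_le_gapHi τ 1| ≤ 1 := by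
  have hκ := h₁.κ_pos
  have h7 := h₂.seven_le_gapLo
  have h7' := h₂.seven_le_gapHi
  rw [abs_le]
  rcases le_or_gt τ (b₂.parLo hκ h7 five_mem) with h5 | h5
  · rw [b₂.deepTrack_of_le hκ h7 h7' h5, lowerTurn_apply_one]
    have := turnV_mem ((b₂.alphaLo_le_iff' hκ h7 five_mem (b₂.mem_coreLo_of_zone hκ h7 ⟨hτ.1, h5⟩)).2 h5)
    exact ⟨this.1, by linarith [this.2]⟩
  rcases lt_or_ge τ (b₂.parHi hκ h7' five_mem) with h5' | h5'
  · have := b₂.deepTrack_one_mem_of_mem hκ h7 h7' ⟨h5.le, h5'.le⟩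
    exact ⟨by linarith [this.1], by linarith [this.2]⟩
  · rw [b₂.deepTrack_of_ge hκ h7 h7' h5', upperTurn_apply_one]
    have := turnV_mem ((b₂.alphaHi_le_iff' hκ h7' five_mem (b₂.mem_coreHi_of_zone hκ h7' ⟨h5', hτ.2⟩)).2 h5')
    exact ⟨by linarith [this.2], by linarith [this.1]⟩

/-- **On the open foreign zone the level of the junction clock exceeds `1`**: for
`σ ∈ (parHi₁ (-1), parLo₁ (-1) + 1)`, `Θ σ = ϑ σ ∈ (parLo₂ 1, parHi₂ 1)`. [folklore] -/
theorem theta_mem_Ioo_one {σ : ℝ} (hσ : σ ∈ Ioo (b₁.parHi h₁.κ_pos h₁.seven_le_gapHi neg_one_mem) (b₁.parLo h₁.κ_pos h₁.seven_le_gapLo neg_one_mem + 1)) :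
    theta h₁ h₂ σ ∈ Ioo (b₂.parLo h₁.κ_pos h₂.seven_le_gapLo (v := 1) ⟨by norm_num, by norm_num⟩)
      (b₂.parHi h₁.κ_pos h₂.seven_le_gapHi (v := 1) ⟨by norm_num, by norm_num⟩) := by
  have hκ := h₁.κ_pos
  obtain ⟨j1, j2⟩ := jc_junctions h₁ h₂
  have hmono := strictMonoOn_junctionClock b₁ b₂ hκ h₁.seven_le_gapLo h₁.seven_le_gapHi h₂.seven_le_gapLo h₂.seven_le_gapHi
  have z1 := b₁.parHi_le_parHi hκ h₁.seven_le_gapHi neg_one_mem neg_half_mem (by norm_num)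
  have z1' := b₁.parHi_le_parHi hκ h₁.seven_le_gapHi neg_one_mem neg_three_quarters_mem (by norm_num)
  have z2 := b₁.parLo_le_parLo hκ h₁.seven_le_gapLo neg_one_mem neg_half_mem (by norm_num)
  have z2' := b₁.parLo_le_parLo hκ h₁.seven_le_gapLo neg_one_mem neg_three_quarters_mem (by norm_num)
  have c1 := (b₁.parHi_mem_core hκ h₁.seven_le_gapHi neg_one_mem).2
  have c2 := (b₁.parLo_mem_core hκ h₁.seven_le_gapLo neg_one_mem).1
  have hcm := b₁.core_marks
  rw [theta_eq h₁ h₂ ⟨by linarith [hσ.1], by linarith [hσ.2]⟩]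
  have hmemL : b₁.parHi hκ h₁.seven_le_gapHi neg_one_mem ∈ Icc (b₁.parHi hκ h₁.seven_le_gapHi neg_half_mem) (b₁.parLo hκ h₁.seven_le_gapLo neg_half_mem + 1) :=
    ⟨z1, by linarith⟩
  have hmemR : b₁.parLo hκ h₁.seven_le_gapLo neg_one_mem + 1 ∈ Icc (b₁.parHi hκ h₁.seven_le_gapHi neg_half_mem) (b₁.parLo hκ h₁.seven_le_gapLo neg_half_mem + 1) :=
    ⟨by linarith, by linarith⟩
  have hm : σ ∈ Icc (b₁.parHi hκ h₁.seven_le_gapHi neg_half_mem) (b₁.parLo hκ h₁.seven_le_gapLo neg_half_mem + 1) :=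
    ⟨by linarith [hσ.1], by linarith [hσ.2]⟩
  constructor
  · rw [← j1]; exact hmono hmemL hm hσ.1
  · rw [← j2]; exact hmono hm hmemR hσ.2

/-- First coordinate of the flipped track. [folklore] -/
theorem flipTrack_apply_zero (τ : ℝ) : flipTrack h₁ h₂ τ 0 = 2⁻¹ - κ * b₂.deepTrack h₁.κ_pos h₂.seven_le_gapLo h₂.seven_le_gapHi τ 0 := by
  simp [flipTrack]

/-- Second coordinate of the flipped track. [folklore] -/
theorem flipTrack_apply_one (τ : ℝ) : flipTrack h₁ h₂ τ 1 = 2⁻¹ - κ * b₂.deepTrack h₁.κ_pos h₂.seven_le_gapLo h₂.seven_le_gapHi τ 1 := by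
  simp [flipTrack]

/-- **The track on the open foreign zone**: first coordinate `< 1/2 - κ` and `≥ 1/2 - 5κ`, height in
`[1/2 - κ, 1/2 + κ]`. [folklore] -/
theorem cleanQ_foreign_bounds {σ : ℝ} (hσ : σ ∈ Ioo (b₁.parHi h₁.κ_pos h₁.seven_le_gapHi neg_one_mem) (b₁.parLo h₁.κ_pos h₁.seven_le_gapLo neg_one_mem + 1)) :
    cleanQ h₁ h₂ σ 0 < 2⁻¹ - κ ∧ 2⁻¹ - 5 * κ ≤ cleanQ h₁ h₂ σ 0 ∧ |cleanQ h₁ h₂ σ 1 - 2⁻¹| ≤ κ := by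
  have hκ := h₁.κ_pos
  rw [cleanQ_of_mem h₁ h₂ hσ]
  obtain ⟨hlo, hhi⟩ := theta_mem_Ioo_one h₁ h₂ hσ
  have h1m : (1 : ℝ) ∈ Icc (0 : ℝ) 1 := ⟨by norm_num, le_rfl⟩
  -- first coordinate: `X > 1` strictly, from the strict level bound
  have hX : 1 < b₂.deepTrack hκ h₂.seven_le_gapLo h₂.seven_le_gapHi (theta h₁ h₂ σ) 0 ∧
      b₂.deepTrack hκ h₂.seven_le_gapLo h₂.seven_le_gapHi (theta h₁ h₂ σ) 0 ≤ 5 := by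
    have h7 := h₂.seven_le_gapLo
    have h7' := h₂.seven_le_gapHi
    have h17 : (1 : ℝ) ∈ Icc (-7 : ℝ) 7 := ⟨by norm_num, by norm_num⟩
    set τ := theta h₁ h₂ σ
    have hτ : τ ∈ Icc (b₂.parLo hκ h7 h17) (b₂.parHi hκ h7' h17) := ⟨hlo.le, hhi.le⟩
    refine ⟨?_, (deepTrack_zero_mem h₁ h₂ h1m hτ).2⟩
    rcases le_or_gt τ (b₂.parLo hκ h7 five_mem) with h5 | h5
    · have hc := b₂.mem_coreLo_of_zone hκ h7 ⟨(b₂.parLo_le_parLo hκ h7 neg_seven_mem h17 (by norm_num)).trans hτ.1, h5⟩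
      have ha1 : 1 < b₂.alphaLo κ τ := (b₂.lt_alphaLo_iff' hκ h7 h17 hc).2 hlo
      rw [b₂.deepTrack_of_le hκ h7 h7' h5, lowerTurn_apply_zero]
      rcases le_or_gt (b₂.alphaLo κ τ) 4 with h4 | h4
      · exact lt_of_lt_of_le ha1 (turnX_mem_of_le h4).1
      · linarith [(turnX_le_of_ge h4.le).1]
    rcases lt_or_ge τ (b₂.parHi hκ h7' five_mem) with h5' | h5'
    · rw [b₂.deepTrack_of_mem hκ h7 h7' ⟨h5, h5'⟩, pt2_apply_zero]; norm_num
    · have hc := b₂.mem_coreHi_of_zone hκ h7' ⟨h5', hτ.2.trans (b₂.parHi_le_parHi hκ h7' neg_seven_mem h17 (by norm_num))⟩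
      have ha1 : 1 < b₂.alphaHi κ τ := (b₂.lt_alphaHi_iff' hκ h7' h17 hc).2 hhi
      rw [b₂.deepTrack_of_ge hκ h7 h7' h5', upperTurn_apply_zero]
      rcases le_or_gt (b₂.alphaHi κ τ) 4 with h4 | h4
      · exact lt_of_lt_of_le ha1 (turnX_mem_of_le h4).1
      · linarith [(turnX_le_of_ge h4.le).1]
  have hY := abs_deepTrack_one_le h₁ h₂ (τ := theta h₁ h₂ σ) (Ioo_subset_Icc_self (theta_mem_Ioo h₁ h₂ σ))
  rw [flipTrack_apply_zero, flipTrack_apply_one]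
  refine ⟨by nlinarith [hX.1], by nlinarith [hX.2], ?_⟩
  rw [show 2⁻¹ - κ * b₂.deepTrack hκ h₂.seven_le_gapLo h₂.seven_le_gapHi (theta h₁ h₂ σ) 1 - 2⁻¹ =
    -(κ * b₂.deepTrack hκ h₂.seven_le_gapLo h₂.seven_le_gapHi (theta h₁ h₂ σ) 1) by ring, abs_neg, abs_mul, abs_of_pos hκ]
  nlinarith

/-! ### The track on the two arches of `b₁` -/

/-- **On the upper edge zone the track is the right edge at height `gUp`.** [folklore] -/
theorem cleanQ_of_le_edge {σ : ℝ} (hσ : σ ≤ b₁.thi + b₁.epsHi) : cleanQ h₁ h₂ σ = pt2 1 (b₁.gUp σ) := by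
  have hw := b₁.tcHi_window
  have hε := b₁.epsHi_bounds.1
  have hz : σ ≤ b₁.parHi h₁.κ_pos h₁.seven_le_gapHi neg_five_quarters_mem := by
    have := (b₁.parHi_mem_core h₁.κ_pos h₁.seven_le_gapHi neg_five_quarters_mem).1; linarith
  rw [cleanQ_eq_neckUp h₁ h₂ hz, b₁.neckUp_eq_railUp (fun hm ↦ by linarith [hm.1]), b₁.railUp_eq_right hσ]

/-- **On the shifted lower edge zone the track is the right edge at height `gLo (σ - 1)`.** [folklore] -/
theorem cleanQ_of_ge_edge {σ : ℝ} (hσ : b₁.tlo + 1 - b₁.epsLo ≤ σ) : cleanQ h₁ h₂ σ = pt2 1 (b₁.gLo (σ - 1)) := by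
  have hw := b₁.tcLo_window
  have hε := b₁.epsLo_bounds.1
  have hz : b₁.parLo h₁.κ_pos h₁.seven_le_gapLo neg_seven_halves_mem + 1 ≤ σ := by
    have := (b₁.parLo_mem_core h₁.κ_pos h₁.seven_le_gapLo neg_seven_halves_mem).2; linarith
  rw [cleanQ_eq_neckLo h₁ h₂ hz, b₁.neckLo_eq_railLo (fun hm ↦ by linarith [hm.2]), b₁.railLo_eq_right (by linarith)]

/-- First coordinate of the track on the upper arch zone `(-∞, parHi₁ (-5/4)]`: that of the upper
rail arch. [folklore] -/
theorem cleanQ_zero_of_le {σ : ℝ} (hσ : σ ≤ b₁.parHi h₁.κ_pos h₁.seven_le_gapHi neg_five_quarters_mem) :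
    cleanQ h₁ h₂ σ 0 = b₁.railUp σ 0 := by
  rw [cleanQ_eq_neckUp h₁ h₂ hσ, neckUp_apply_zero]

/-- First coordinate of the track on the lower arch zone `[parLo₁ (-7/2) + 1, ∞)`: that of the lower
rail arch (shifted). [folklore] -/
theorem cleanQ_zero_of_ge {σ : ℝ} (hσ : b₁.parLo h₁.κ_pos h₁.seven_le_gapLo neg_seven_halves_mem + 1 ≤ σ) :
    cleanQ h₁ h₂ σ 0 = b₁.railLo (σ - 1) 0 := by
  rw [cleanQ_eq_neckLo h₁ h₂ hσ, neckLo_apply_zero]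

/-- **Heights of the track on the upper arch zone** `[thi₁, parHi₁ (-5/4)]`: in `[1/2 + κ, 9/10)`.
[folklore] -/
theorem cleanQ_one_mem_of_le {σ : ℝ} (hσ : σ ∈ Icc b₁.thi (b₁.parHi h₁.κ_pos h₁.seven_le_gapHi neg_five_quarters_mem)) :
    cleanQ h₁ h₂ σ 1 ∈ Ico (2⁻¹ + κ) (9 / 10 : ℝ) := by
  have hκ := h₁.κ_pos
  have hκ12 := h₁.κ_le
  have hw := b₁.tcHi_window
  have hε := b₁.epsHi_bounds.1
  have hc2 := (b₁.parHi_mem_core hκ h₁.seven_le_gapHi neg_five_quarters_mem).2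
  have hahi : σ ≤ b₁.ahi := by linarith [hσ.2]
  rw [cleanQ_eq_neckUp h₁ h₂ hσ.2]
  have hr := (b₁.railUp_mem ⟨hσ.1, hahi⟩).2
  by_cases hn : σ ∈ Icc (b₁.tcHi - b₁.epsHi / 2) (b₁.tcHi + b₁.epsHi / 2)
  · have hm := b₁.neckUp_one_mem h₁.κ_le_quarter ⟨zero_le_one, le_rfl⟩ (w := κ) hn
    have hle : b₁.neckUp κ 1 σ 1 ≤ b₁.railUp σ 1 := by
      rw [neckUp_apply_one]
      have := neckBump_mem_Icc b₁.tcHi (b₁.epsHi / 8) σ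
      have hk := h₁.κ_le_quarter
      nlinarith [this.1]
    exact ⟨by linarith [hm.1], by linarith [hr.2]⟩
  · have hn' : σ ∉ Ioo (b₁.tcHi - 2 * (b₁.epsHi / 8)) (b₁.tcHi + 2 * (b₁.epsHi / 8)) := fun h ↦ hn ⟨by linarith [h.1], by linarith [h.2]⟩
    rw [b₁.neckUp_eq_railUp hn']
    exact ⟨by linarith [hr.1], hr.2⟩

/-- **Heights of the track on the lower arch zone** `[parLo₁ (-7/2) + 1, tlo₁ + 1]`: in `(1/10, 1/2 - κ]`.
[folklore] -/
theorem cleanQ_one_mem_of_ge {σ : ℝ} (hσ : σ ∈ Icc (b₁.parLo h₁.κ_pos h₁.seven_le_gapLo neg_seven_halves_mem + 1) (b₁.tlo + 1)) :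
    cleanQ h₁ h₂ σ 1 ∈ Ioc (10⁻¹ : ℝ) (2⁻¹ - κ) := by
  have hκ := h₁.κ_pos
  have hκ12 := h₁.κ_le
  have hw := b₁.tcLo_window
  have hε := b₁.epsLo_bounds.1
  have hc1 := (b₁.parLo_mem_core hκ h₁.seven_le_gapLo neg_seven_halves_mem).1
  have halo : b₁.alo ≤ σ - 1 := by linarith [hσ.1]
  rw [cleanQ_eq_neckLo h₁ h₂ hσ.1]
  have hr := (b₁.railLo_mem ⟨halo, by linarith [hσ.2]⟩).2
  by_cases hn : σ - 1 ∈ Icc (b₁.tcLo - b₁.epsLo / 2) (b₁.tcLo + b₁.epsLo / 2)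
  · have hm := b₁.neckLo_one_mem h₁.κ_le_quarter ⟨zero_le_one, le_rfl⟩ (w := κ) hn
    have hle : b₁.railLo (σ - 1) 1 ≤ b₁.neckLo κ 1 (σ - 1) 1 := by
      rw [neckLo_apply_one]
      have := neckBump_mem_Icc b₁.tcLo (b₁.epsLo / 8) (σ - 1)
      have hk := h₁.κ_le_quarter
      nlinarith [this.1]
    exact ⟨by linarith [hr.1], by linarith [hm.2]⟩
  · have hn' : σ - 1 ∉ Ioo (b₁.tcLo - 2 * (b₁.epsLo / 8)) (b₁.tcLo + 2 * (b₁.epsLo / 8)) := fun h ↦ hn ⟨by linarith [h.1], by linarith [h.2]⟩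
    rw [b₁.neckLo_eq_railLo hn']
    exact ⟨hr.1, by linarith [hr.2]⟩

/-! ### The frame knot on the band part -/

/-- **The reflected arc at `u = 0` is the band image of the flipped track.** [folklore] -/
theorem foreignPt_zero_eq_band_flipTrack (hP : IsFlipPair b₁ b₂) {τ : ℝ}
    (hτ : τ ∈ Icc (b₂.parLo h₁.κ_pos h₂.seven_le_gapLo neg_seven_mem) (b₂.parHi h₁.κ_pos h₂.seven_le_gapHi neg_seven_mem)) :
    foreignPt h₁ h₂ 0 τ = ((b₁.band (flipTrack h₁ h₂ τ) : 𝕊 3) : 𝔼 4) := by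
  have hκ := h₁.κ_pos
  have hq := b₂.norm_smul_deepTrack_lt hcross₂ hκ h₂.seven_le_gapLo h₂.seven_le_gapHi h₂.nine_le_poleRad hτ
  rw [foreignPt, b₂.arcChart_zero hκ h₂.seven_le_gapLo h₂.seven_le_gapHi hτ, Fband,
    psiN_symm_apply_psiN (b₂.band_ne_northPole_of_norm_lt hcross₂ hq), flipTrack, sub_eq_add_neg, hP.band_centre_add, neg_neg]

variable {hP : IsFlipPair b₁ b₂} (hT : PairScale hP hcross₂ hcross₁ κ)

/-- **The knot of the un-spiked flip frame at `u = 0`.** [folklore] -/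
def frameKnotZero (hA₁ : A₁.InNorth) (hB₁ : B₁.InSouth) (hAB₁ : Disjoint (range A₁) (range B₁)) (hB₂ : B₂.InSouth) : Knot :=
  (isNeckFrame_flipBase h₁ h₂ hT hA₁ hB₁ hAB₁ hB₂ (u := 0) ⟨le_rfl, zero_le_one⟩).frameKnot

/-- The curve of the frame knot is the periodised flip frame. [folklore] -/
theorem curve_frameKnotZero (hA₁ : A₁.InNorth) (hB₁ : B₁.InSouth) (hAB₁ : Disjoint (range A₁) (range B₁)) (hB₂ : B₂.InSouth) (σ : ℝ) :
    Knot.curve (frameKnotZero h₁ h₂ hT hA₁ hB₁ hAB₁ hB₂) σ = periodise b₁.alo (flipBase h₁ h₂ 0) σ := by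
  rw [Knot.curve_apply, frameKnotZero, IsNeckFrame.coe_frameKnot_circlePt]

include hT in
/-- **THE FRAME KNOT ON THE BAND PART IS THE BAND IMAGE OF THE TRACK**: for `σ ∈ [thi₁, tlo₁ + 1)`.
[folklore] -/
theorem curve_frameKnotZero_eq_band (hA₁ : A₁.InNorth) (hB₁ : B₁.InSouth) (hAB₁ : Disjoint (range A₁) (range B₁)) (hB₂ : B₂.InSouth)
    {σ : ℝ} (hσ : σ ∈ Ico b₁.thi (b₁.tlo + 1)) :
    Knot.curve (frameKnotZero h₁ h₂ hT hA₁ hB₁ hAB₁ hB₂) σ = ((b₁.band (cleanQ h₁ h₂ σ) : 𝕊 3) : 𝔼 4) := by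
  have hκ := h₁.κ_pos
  have hcm := b₁.core_marks
  have hm := b₁.marks_lt
  have hw := b₁.tcHi_window
  have hw' := b₁.tcLo_window
  have c1 := (b₁.parHi_mem_core hκ h₁.seven_le_gapHi neg_one_mem).2
  have c1' := (b₁.parHi_mem_core hκ h₁.seven_le_gapHi neg_one_mem).1
  have c2 := (b₁.parLo_mem_core hκ h₁.seven_le_gapLo neg_one_mem).1
  have c2' := (b₁.parLo_mem_core hκ h₁.seven_le_gapLo neg_one_mem).2
  rw [curve_frameKnotZero]
  rcases lt_or_ge σ (b₁.alo + 1) with ha | ha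
  · rw [periodise_eq_self b₁.alo _ ⟨by linarith [hσ.1], ha⟩]
    rcases le_or_gt σ (b₁.parHi hκ h₁.seven_le_gapHi neg_one_mem) with h1 | h1
    · rw [flipBase_of_mem h₁ h₂ ⟨by linarith [hσ.1], h1⟩, cleanQ_of_le h₁ h₂ h1,
        b₁.neckPiece_of_thi_le hσ.1 (by linarith)]
    · rw [flipBase_of_gt h₁ h₂ h1, cleanQ_of_mem h₁ h₂ ⟨h1, by linarith⟩,
        foreignPt_zero_eq_band_flipTrack h₁ h₂ hP (Ioo_subset_Icc_self (theta_mem_Ioo h₁ h₂ σ))]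
  · have hred : periodise b₁.alo (flipBase h₁ h₂ 0) σ = flipBase h₁ h₂ 0 (σ - 1) := by
      have := periodise_eq_of_mem b₁.alo (flipBase h₁ h₂ 0) (t := σ) (n := 1) (by push_cast; exact ⟨by linarith, by linarith [hσ.2]⟩)
      push_cast at this; exact this
    rw [hred]
    rcases lt_or_ge (σ - 1) (b₁.parLo hκ h₁.seven_le_gapLo neg_one_mem) with h1 | h1
    · rw [flipBase_of_lt h₁ h₂ h1, sub_add_cancel, cleanQ_of_mem h₁ h₂ ⟨by linarith, by linarith⟩,
        foreignPt_zero_eq_band_flipTrack h₁ h₂ hP (Ioo_subset_Icc_self (theta_mem_Ioo h₁ h₂ σ))]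
    · rw [flipBase_of_mem h₁ h₂ ⟨h1, by linarith [hσ.2]⟩, cleanQ_of_ge h₁ h₂ (by linarith),
        b₁.neckPiece_of_lt_tlo (by linarith [hσ.2])]

include hT in
/-- **OFF THE BAND PART THE FRAME KNOT IS THE SECOND SUMMAND**: for `t ∈ [tlo₁ - epsLo, thi₁ + epsHi]`,
`X (circlePt t) = B₁ (circlePt (psi₁ t))`. [folklore] -/
theorem frameKnotZero_circlePt_eq_B (hA₁ : A₁.InNorth) (hB₁ : B₁.InSouth) (hAB₁ : Disjoint (range A₁) (range B₁)) (hB₂ : B₂.InSouth)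
    {t : ℝ} (ht : t ∈ Icc (b₁.tlo - b₁.epsLo) (b₁.thi + b₁.epsHi)) :
    frameKnotZero h₁ h₂ hT hA₁ hB₁ hAB₁ hB₂ (circlePt t) = B₁ (circlePt (b₁.psi t)) := by
  have hκ := h₁.κ_pos
  have hcm := b₁.core_marks
  have hm := b₁.marks_lt
  have hw := b₁.tcHi_window
  have hw' := b₁.tcLo_window
  have c1' := (b₁.parHi_mem_core hκ h₁.seven_le_gapHi neg_one_mem).1
  have c2' := (b₁.parLo_mem_core hκ h₁.seven_le_gapLo neg_one_mem).2
  obtain ⟨l1, l2⟩ := b₁.tlo_marksB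
  obtain ⟨u1, u2⟩ := b₁.thi_marksB
  apply Subtype.ext
  rw [← Knot.curve_apply, curve_frameKnotZero, periodise_eq_self b₁.alo _ ⟨by linarith [ht.1], by linarith [ht.2]⟩,
    flipBase_of_mem h₁ h₂ ⟨by linarith [ht.1], by linarith [ht.2]⟩]
  rcases lt_or_ge t b₁.tlo with h1 | h1
  · rw [b₁.neckPiece_of_lt_tlo h1, b₁.neckLo_eq_railLo (fun hh ↦ by linarith [hh.2, ht.1]), b₁.band_railLo_eq_B ⟨ht.1, by linarith⟩]
  rcases lt_or_ge t b₁.thi with h2 | h2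
  · rw [b₁.neckPiece_of_tlo_le h1 h2, Knot.curve_apply]
  · rw [b₁.neckPiece_of_thi_le h2 (by linarith [ht.2]), b₁.neckUp_eq_railUp (fun hh ↦ by linarith [hh.1, ht.2]),
      b₁.band_railUp_eq_B ⟨by linarith, ht.2⟩]

/-! ### The cleaning family is a planar family in the band -/

omit h₂ in
/-- A planar curve is regular where one of its coordinates has nonzero derivative. [folklore] -/
theorem deriv_ne_zero_of_coord {f : ℝ → 𝔼 2} {s : ℝ} (hf : DifferentiableAt ℝ f s) (i : Fin 2)
    (h : deriv (fun s ↦ f s i) s ≠ 0) : deriv f s ≠ 0 := by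
  intro h0
  have hc := ((EuclideanSpace.proj i : 𝔼 2 →L[ℝ] ℝ).hasFDerivAt.comp_hasDerivAt s hf.hasDerivAt).deriv
  have e : ((EuclideanSpace.proj i : 𝔼 2 →L[ℝ] ℝ) ∘ f) = fun s ↦ f s i := rfl
  rw [e, h0, map_zero] at hc
  exact h hc

/-- The loops of the family are differentiable. [folklore] -/
theorem differentiableAt_cleanP (u s : ℝ) : DifferentiableAt ℝ (cleanP h₁ h₂ u) s :=
  (((contDiff_cleanP h₁ h₂).comp (contDiff_const.prodMk contDiff_id)).differentiable (by simp)) s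

/-- **The upper start of the band part: the height strictly decreases** (`u ∈ [0, 1]`,
`s ∈ [thi₁, thi₁ + 3 epsHi/2)`). [folklore] -/
theorem deriv_cleanP_one_neg_of_start {u : ℝ} (hu : u ∈ Icc (0 : ℝ) 1) {s : ℝ} (hs : s ∈ Ico b₁.thi (b₁.thi + 3 / 2 * b₁.epsHi)) :
    deriv (fun s ↦ cleanP h₁ h₂ u s 1) s < 0 := by
  have hκ := h₁.κ_pos
  have hκ12 := h₁.κ_le
  have hw := b₁.tcHi_window
  have hε := b₁.epsHi_bounds.1
  obtain ⟨u1, u2⟩ := b₁.thi_marksB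
  have n5 := (b₁.parHi_mem_core hκ h₁.seven_le_gapHi neg_five_quarters_mem).1
  have hev : (fun s ↦ cleanP h₁ h₂ u s 1) =ᶠ[𝓝 s] fun s ↦ (1 - u) * b₁.gUp s + u * b₁.hcUp κ s := by
    filter_upwards [Iio_mem_nhds hs.2] with t ht
    have ht' : t < b₁.thi + 3 / 2 * b₁.epsHi := ht
    have htz : t ≤ b₁.parHi hκ h₁.seven_le_gapHi neg_five_quarters_mem := by linarith
    rw [cleanP_apply_one, cleanH_of_le h₁ h₂ (by linarith), cleanQ_eq_neckUp h₁ h₂ htz,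
      b₁.neckUp_eq_railUp (fun hh ↦ by linarith [hh.1]), b₁.railUp_one_eq_gUp ht'.le]
  rw [hev.deriv_eq]
  have hg : HasDerivAt b₁.gUp (deriv b₁.gUp s) s := ((b₁.gUp_spec.1.differentiable (by simp)) s).hasDerivAt
  have hh : HasDerivAt (b₁.hcUp κ) (deriv (b₁.hcUp κ) s) s := (((b₁.contDiff_hcUp κ).differentiable (by simp)) s).hasDerivAt
  have hsum : HasDerivAt (fun s ↦ (1 - u) * b₁.gUp s + u * b₁.hcUp κ s) ((1 - u) * deriv b₁.gUp s + u * deriv (b₁.hcUp κ) s) s :=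
    (hg.const_mul (1 - u)).add (hh.const_mul u)
  rw [hsum.deriv]
  have h1 := b₁.deriv_gUp_neg (show s ≤ b₁.thi + 2 * b₁.epsHi by linarith [hs.2])
  have h2 := b₁.deriv_hcUp_nonpos (w := κ) (by linarith) (show b₁.psiInv (b₁.thetaB (17 / 20) + 1) ≤ s by linarith [hs.1])
  have h3 := b₁.deriv_hcUp_neg (w := κ) (by linarith) (show b₁.psiInv (b₁.thetaB (17 / 20) + 1) ≤ s by linarith [hs.1])
    (show s < b₁.thi + 2 * b₁.epsHi by linarith [hs.2])
  rcases hu.2.lt_or_eq with hu1 | hu1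
  · nlinarith [hu.1]
  · rw [hu1]; linarith

/-- **The lower end of the band part: the height strictly decreases** (`u ∈ [0, 1]`,
`s ∈ (tlo₁ + 1 - 3 epsLo/2, tlo₁ + 1]`). [folklore] -/
theorem deriv_cleanP_one_neg_of_end {u : ℝ} (hu : u ∈ Icc (0 : ℝ) 1) {s : ℝ} (hs : s ∈ Ioc (b₁.tlo + 1 - 3 / 2 * b₁.epsLo) (b₁.tlo + 1)) :
    deriv (fun s ↦ cleanP h₁ h₂ u s 1) s < 0 := by
  have hκ := h₁.κ_pos
  have hκ12 := h₁.κ_le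
  have hw := b₁.tcLo_window
  have hε := b₁.epsLo_bounds.1
  have hcm := b₁.core_marks
  obtain ⟨l1, l2⟩ := b₁.tlo_marksB
  have hz0 := (b₁.parLo_mem_core hκ h₁.seven_le_gapLo neg_seven_halves_mem).2
  have hev : (fun s ↦ cleanP h₁ h₂ u s 1) =ᶠ[𝓝 s] fun s ↦ (1 - u) * b₁.gLo (s - 1) + u * b₁.hcLo κ (s - 1) := by
    filter_upwards [Ioi_mem_nhds hs.1] with t ht
    have ht' : b₁.tlo + 1 - 3 / 2 * b₁.epsLo < t := ht
    rw [cleanP_apply_one, cleanH_of_gt h₁ h₂ (by linarith), cleanQ_eq_neckLo h₁ h₂ (by linarith),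
      b₁.neckLo_eq_railLo (fun hh ↦ by linarith [hh.2]), b₁.railLo_one_eq_gLo (by linarith)]
  rw [hev.deriv_eq]
  have hg0 : HasDerivAt b₁.gLo (deriv b₁.gLo (s - 1)) (s - 1) := ((b₁.gLo_spec.1.differentiable (by simp)) _).hasDerivAt
  have hh0 : HasDerivAt (b₁.hcLo κ) (deriv (b₁.hcLo κ) (s - 1)) (s - 1) := (((b₁.contDiff_hcLo κ).differentiable (by simp)) _).hasDerivAt
  have hsub : HasDerivAt (fun t : ℝ ↦ t - 1) 1 s := (hasDerivAt_id s).sub_const 1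
  have hg : HasDerivAt (fun t ↦ b₁.gLo (t - 1)) (deriv b₁.gLo (s - 1) * 1) s := HasDerivAt.comp (h₂ := b₁.gLo) (h := fun t : ℝ ↦ t - 1) s hg0 hsub
  have hh : HasDerivAt (fun t ↦ b₁.hcLo κ (t - 1)) (deriv (b₁.hcLo κ) (s - 1) * 1) s := HasDerivAt.comp (h₂ := b₁.hcLo κ) (h := fun t : ℝ ↦ t - 1) s hh0 hsub
  have hsum : HasDerivAt (fun t ↦ (1 - u) * b₁.gLo (t - 1) + u * b₁.hcLo κ (t - 1))
      ((1 - u) * (deriv b₁.gLo (s - 1) * 1) + u * (deriv (b₁.hcLo κ) (s - 1) * 1)) s :=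
    (hg.const_mul (1 - u)).add (hh.const_mul u)
  rw [hsum.deriv, mul_one, mul_one]
  have h1 := b₁.deriv_gLo_neg (show b₁.tlo - 2 * b₁.epsLo ≤ s - 1 by linarith [hs.1])
  have h2 := b₁.deriv_hcLo_nonpos (w := κ) (by linarith) (show s - 1 ≤ b₁.psiInv (b₁.thetaB (3 / 20)) by linarith [hs.2])
  have h3 := b₁.deriv_hcLo_neg (w := κ) (by linarith) (show s - 1 ≤ b₁.psiInv (b₁.thetaB (3 / 20)) by linarith [hs.2])
    (show b₁.tlo - 2 * b₁.epsLo < s - 1 by linarith [hs.1])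
  rcases hu.2.lt_or_eq with hu1 | hu1
  · nlinarith [hu.1]
  · rw [hu1]; linarith

/-- On `(tcHi₁, tcLo₁ + 1)` the loops of the family are the track, near every point. [folklore] -/
theorem cleanP_eventuallyEq_cleanQ (u : ℝ) {s : ℝ} (hs : s ∈ Ioo b₁.tcHi (b₁.tcLo + 1)) : cleanP h₁ h₂ u =ᶠ[𝓝 s] cleanQ h₁ h₂ := by
  filter_upwards [Ioo_mem_nhds hs.1 hs.2] with t ht using cleanP_eq_of_eq h₁ h₂ (cleanH_of_mem h₁ h₂ ⟨ht.1, ht.2.le⟩) u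

/-- **The track is regular on the extended foreign zone.** [folklore] -/
theorem deriv_cleanQ_ne_zero_foreign {s : ℝ}
    (hs : s ∈ Ioo (b₁.parHi h₁.κ_pos h₁.seven_le_gapHi neg_three_quarters_mem) (b₁.parLo h₁.κ_pos h₁.seven_le_gapLo neg_three_quarters_mem + 1)) :
    deriv (cleanQ h₁ h₂) s ≠ 0 := by
  have hκ := h₁.κ_pos
  have hev : cleanQ h₁ h₂ =ᶠ[𝓝 s] fun s ↦ flipTrack h₁ h₂ (theta h₁ h₂ s) := by
    filter_upwards [Ioo_mem_nhds hs.1 hs.2] with t ht using cleanQ_eq_flipTrack h₁ h₂ (Ioo_subset_Icc_self ht)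
  rw [hev.deriv_eq]
  obtain ⟨hθ, hpos⟩ := hasDerivAt_theta h₁ h₂ hs
  have hτ := Ioo_subset_Icc_self (theta_mem_Ioo h₁ h₂ s)
  have hD : HasDerivAt (b₂.deepTrack hκ h₂.seven_le_gapLo h₂.seven_le_gapHi)
      (deriv (b₂.deepTrack hκ h₂.seven_le_gapLo h₂.seven_le_gapHi) (theta h₁ h₂ s)) (theta h₁ h₂ s) :=
    (((b₂.contDiff_deepTrack hκ h₂.seven_le_gapLo h₂.seven_le_gapHi).differentiable (by simp)) _).hasDerivAt
  have hcomp : HasDerivAt (fun s ↦ b₂.deepTrack hκ h₂.seven_le_gapLo h₂.seven_le_gapHi (theta h₁ h₂ s))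
      (deriv (jc h₁ h₂) s • deriv (b₂.deepTrack hκ h₂.seven_le_gapLo h₂.seven_le_gapHi) (theta h₁ h₂ s)) s :=
    HasDerivAt.scomp (g₁ := b₂.deepTrack hκ h₂.seven_le_gapLo h₂.seven_le_gapHi) (h := theta h₁ h₂) s hD hθ
  have hF : HasDerivAt (fun s ↦ flipTrack h₁ h₂ (theta h₁ h₂ s))
      (0 - κ • (deriv (jc h₁ h₂) s • deriv (b₂.deepTrack hκ h₂.seven_le_gapLo h₂.seven_le_gapHi) (theta h₁ h₂ s))) s :=
    (hasDerivAt_const s _).sub (hcomp.const_smul κ)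
  rw [hF.deriv, zero_sub, neg_ne_zero]
  exact smul_ne_zero hκ.ne' (smul_ne_zero hpos.ne' (b₂.deriv_deepTrack_ne_zero hκ h₂.seven_le_gapLo h₂.seven_le_gapHi hτ))

/-- **THE LOOPS OF THE FAMILY ARE REGULAR ON THE BAND PART** (`u ∈ [0, 1]`, `s ∈ [thi₁, tlo₁ + 1]`).
[folklore] -/
theorem deriv_cleanP_ne_zero {u : ℝ} (hu : u ∈ Icc (0 : ℝ) 1) {s : ℝ} (hs : s ∈ Icc b₁.thi (b₁.tlo + 1)) :
    deriv (cleanP h₁ h₂ u) s ≠ 0 := by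
  have hκ := h₁.κ_pos
  have hw := b₁.tcHi_window
  have hw' := b₁.tcLo_window
  have hε := b₁.epsLo_bounds.1
  have hε' := b₁.epsHi_bounds.1
  have hcm := b₁.core_marks
  have hm := b₁.marks_lt
  have hd := differentiableAt_cleanP h₁ h₂ u s
  have n5 := (b₁.parHi_mem_core hκ h₁.seven_le_gapHi neg_five_quarters_mem).1
  have n5' := (b₁.parHi_mem_core hκ h₁.seven_le_gapHi neg_five_quarters_mem).2
  have n34 := b₁.parHi_lt_parHi hκ h₁.seven_le_gapHi neg_five_quarters_mem neg_three_quarters_mem (by norm_num)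
  have l72 := (b₁.parLo_mem_core hκ h₁.seven_le_gapLo neg_seven_halves_mem).1
  have l72' := (b₁.parLo_mem_core hκ h₁.seven_le_gapLo neg_seven_halves_mem).2
  have l34 := b₁.parLo_lt_parLo hκ h₁.seven_le_gapLo neg_seven_halves_mem neg_three_quarters_mem (by norm_num)
  have l34' := (b₁.parLo_mem_core hκ h₁.seven_le_gapLo neg_three_quarters_mem).2
  have p1 : b₁.tcHi < b₁.parHi hκ h₁.seven_le_gapHi neg_five_quarters_mem := by
    rw [← b₁.parHi_zero hκ h₁.seven_le_gapHi]; exact b₁.parHi_lt_parHi hκ h₁.seven_le_gapHi neg_five_quarters_mem _ (by norm_num)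
  have p2 : b₁.parLo hκ h₁.seven_le_gapLo neg_three_quarters_mem < b₁.tcLo := by
    rw [← b₁.parLo_zero hκ h₁.seven_le_gapLo]; exact b₁.parLo_lt_parLo hκ h₁.seven_le_gapLo neg_three_quarters_mem _ (by norm_num)
  -- (1) start: the height decreases
  rcases lt_or_ge s (b₁.thi + 3 / 2 * b₁.epsHi) with h1 | h1
  · exact deriv_ne_zero_of_coord hd 1 (deriv_cleanP_one_neg_of_start h₁ h₂ hu ⟨hs.1, h1⟩).ne
  -- (2) upper arch inwards: the first coordinate decreases
  rcases lt_or_ge s (b₁.parHi hκ h₁.seven_le_gapHi neg_five_quarters_mem) with h2 | h2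
  · refine deriv_ne_zero_of_coord hd 0 ?_
    have hev : (fun s ↦ cleanP h₁ h₂ u s 0) =ᶠ[𝓝 s] fun s ↦ b₁.railUp s 0 := by
      filter_upwards [Iio_mem_nhds h2] with t ht using by rw [cleanP_apply_zero, cleanQ_zero_of_le h₁ h₂ (le_of_lt ht)]
    rw [hev.deriv_eq]
    have hlo : b₁.thi + b₁.epsHi < s := by linarith
    have hhi : s < b₁.ahi - b₁.epsHi := by linarith [hw.2.1]
    exact (b₁.deriv_railUp_zero_neg ⟨hlo, hhi⟩).ne
  -- (3) the track: no motion on `(tcHi, tcLo + 1)`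
  rcases lt_or_ge s (b₁.parLo hκ h₁.seven_le_gapLo neg_three_quarters_mem + 1) with h3 | h3
  · rw [(cleanP_eventuallyEq_cleanQ h₁ h₂ u ⟨by linarith, by linarith⟩).deriv_eq]
    exact deriv_cleanQ_ne_zero_foreign h₁ h₂ ⟨by linarith, h3⟩
  -- (4) lower arch outwards: the first coordinate increases
  rcases lt_or_ge s (b₁.tlo + 1 - b₁.epsLo) with h4 | h4
  · refine deriv_ne_zero_of_coord hd 0 ?_
    have hev : (fun s ↦ cleanP h₁ h₂ u s 0) =ᶠ[𝓝 s] fun s ↦ b₁.railLo (s - 1) 0 := by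
      filter_upwards [Ioi_mem_nhds (show b₁.parLo hκ h₁.seven_le_gapLo neg_seven_halves_mem + 1 < s by linarith)] with t ht
        using by rw [cleanP_apply_zero, cleanQ_zero_of_ge h₁ h₂ (le_of_lt ht)]
    rw [hev.deriv_eq]
    have hsub : HasDerivAt (fun t : ℝ ↦ t - 1) 1 s := (hasDerivAt_id s).sub_const 1
    have hr : HasDerivAt (fun t ↦ b₁.railLo t 0) (deriv (fun t ↦ b₁.railLo t 0) (s - 1)) (s - 1) :=
      (((contDiff_euclidean.1 b₁.contDiff_railLo 0).differentiable (by simp)) _).hasDerivAt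
    have hc : HasDerivAt (fun t ↦ b₁.railLo (t - 1) 0) (deriv (fun t ↦ b₁.railLo t 0) (s - 1) * 1) s :=
      HasDerivAt.comp (h₂ := fun t ↦ b₁.railLo t 0) (h := fun t : ℝ ↦ t - 1) s hr hsub
    rw [hc.deriv, mul_one]
    exact (b₁.deriv_railLo_zero_pos ⟨by linarith, by linarith⟩).ne'
  -- (5) end: the height decreases
  · exact deriv_ne_zero_of_coord hd 1 (deriv_cleanP_one_neg_of_end h₁ h₂ hu ⟨by linarith, hs.2⟩).ne

/-! ### Coordinates of the family by zones -/

/-- **Zone 1** (upper edge): `cleanP u s = (1, gUp s)` for `s ≤ thi₁ + epsHi`. [folklore] -/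
theorem cleanP_of_le_edge (u : ℝ) {s : ℝ} (hs : s ≤ b₁.thi + b₁.epsHi) : cleanP h₁ h₂ u s = pt2 1 (b₁.gUp s) := by
  rw [cleanP_eq_of_eq h₁ h₂ (cleanH_eq_of_le_edge h₁ h₂ hs).1 u, cleanQ_of_le_edge h₁ h₂ hs]

/-- **Zone 5** (shifted lower edge): `cleanP u s = (1, gLo (s - 1))` for `tlo₁ + 1 - epsLo ≤ s`. [folklore] -/
theorem cleanP_of_ge_edge (u : ℝ) {s : ℝ} (hs : b₁.tlo + 1 - b₁.epsLo ≤ s) : cleanP h₁ h₂ u s = pt2 1 (b₁.gLo (s - 1)) := by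
  rw [cleanP_eq_of_eq h₁ h₂ (cleanH_eq_of_ge_edge h₁ h₂ hs).1 u, cleanQ_of_ge_edge h₁ h₂ hs]

/-- **Zone 2** (upper arch inwards, `s ∈ (thi₁ + epsHi, parHi₁ (-1)]`): first coordinate `railUp s 0`, in
`[1/2 - κ, 1)`. [folklore] -/
theorem cleanP_zero_of_zone2 (u : ℝ) {s : ℝ} (hs : s ∈ Ioc (b₁.thi + b₁.epsHi) (b₁.parHi h₁.κ_pos h₁.seven_le_gapHi neg_one_mem)) :
    cleanP h₁ h₂ u s 0 = b₁.railUp s 0 ∧ b₁.railUp s 0 ∈ Ico (2⁻¹ - κ) 1 := by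
  have hκ := h₁.κ_pos
  have hw := b₁.tcHi_window
  have hε := b₁.epsHi_bounds.1
  have n1 := (b₁.parHi_mem_core hκ h₁.seven_le_gapHi neg_one_mem).2
  have n1' := (b₁.parHi_mem_core hκ h₁.seven_le_gapHi neg_one_mem).1
  have hz : s ≤ b₁.parHi hκ h₁.seven_le_gapHi neg_five_quarters_mem :=
    hs.2.trans (b₁.parHi_le_parHi hκ h₁.seven_le_gapHi neg_five_quarters_mem neg_one_mem (by norm_num))
  refine ⟨by rw [cleanP_apply_zero, cleanQ_zero_of_le h₁ h₂ hz], ?_, (b₁.railUp_zero_mem_Ioo ⟨hs.1, by linarith [hs.2]⟩).2⟩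
  -- `railUp s 0 ≥ railUp (parHi (-1)) 0 = 1/2 - κ`
  have hanti := b₁.strictAntiOn_railUp_zero
  have hN : b₁.railUp (b₁.parHi hκ h₁.seven_le_gapHi neg_one_mem) 0 = 2⁻¹ - κ := by
    rw [show b₁.railUp (b₁.parHi hκ h₁.seven_le_gapHi neg_one_mem) 0 = b₁.chiHi (b₁.parHi hκ h₁.seven_le_gapHi neg_one_mem) from rfl]
    have := b₁.mul_alphaHi hκ.ne' (b₁.parHi hκ h₁.seven_le_gapHi neg_one_mem)
    rw [b₁.alphaHi_parHi hκ h₁.seven_le_gapHi neg_one_mem] at this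
    linarith
  rw [← hN]
  exact hanti.antitoneOn ⟨hs.1.le, by linarith [hs.2]⟩ ⟨by linarith [hs.1, hs.2], by linarith⟩ hs.2

/-- **Zone 4** (lower arch outwards, `s ∈ [parLo₁ (-1) + 1, tlo₁ + 1 - epsLo)`): first coordinate
`railLo (s - 1) 0`, in `[1/2 - κ, 1)`. [folklore] -/
theorem cleanP_zero_of_zone4 (u : ℝ) {s : ℝ} (hs : s ∈ Ico (b₁.parLo h₁.κ_pos h₁.seven_le_gapLo neg_one_mem + 1) (b₁.tlo + 1 - b₁.epsLo)) :
    cleanP h₁ h₂ u s 0 = b₁.railLo (s - 1) 0 ∧ b₁.railLo (s - 1) 0 ∈ Ico (2⁻¹ - κ) 1 := by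
  have hκ := h₁.κ_pos
  have hw := b₁.tcLo_window
  have hε := b₁.epsLo_bounds.1
  have l1 := (b₁.parLo_mem_core hκ h₁.seven_le_gapLo neg_one_mem).1
  have l1' := (b₁.parLo_mem_core hκ h₁.seven_le_gapLo neg_one_mem).2
  have hz : b₁.parLo hκ h₁.seven_le_gapLo neg_seven_halves_mem + 1 ≤ s :=
    le_trans (by linarith [b₁.parLo_le_parLo hκ h₁.seven_le_gapLo neg_seven_halves_mem neg_one_mem (by norm_num)]) hs.1
  refine ⟨by rw [cleanP_apply_zero, cleanQ_zero_of_ge h₁ h₂ hz], ?_, (b₁.railLo_zero_mem_Ioo ⟨by linarith [hs.1], by linarith [hs.2]⟩).2⟩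
  have hmono := b₁.strictMonoOn_railLo_zero
  have hL : b₁.railLo (b₁.parLo hκ h₁.seven_le_gapLo neg_one_mem) 0 = 2⁻¹ - κ := by
    rw [show b₁.railLo (b₁.parLo hκ h₁.seven_le_gapLo neg_one_mem) 0 = b₁.chiLo (b₁.parLo hκ h₁.seven_le_gapLo neg_one_mem) from rfl]
    have := b₁.mul_alphaLo hκ.ne' (b₁.parLo hκ h₁.seven_le_gapLo neg_one_mem)
    rw [b₁.alphaLo_parLo hκ h₁.seven_le_gapLo neg_one_mem] at this
    linarith
  rw [← hL]
  exact hmono.monotoneOn ⟨by linarith, by linarith⟩ ⟨by linarith [hs.1], by linarith [hs.2]⟩ (by linarith [hs.1])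

/-- **Zone 3** (open foreign zone): the family is the track, first coordinate `< 1/2 - κ`. [folklore] -/
theorem cleanP_of_zone3 (u : ℝ) {s : ℝ} (hs : s ∈ Ioo (b₁.parHi h₁.κ_pos h₁.seven_le_gapHi neg_one_mem) (b₁.parLo h₁.κ_pos h₁.seven_le_gapLo neg_one_mem + 1)) :
    cleanP h₁ h₂ u s = cleanQ h₁ h₂ s ∧ cleanQ h₁ h₂ s 0 < 2⁻¹ - κ := by
  have hκ := h₁.κ_pos
  have hcm := b₁.core_marks
  have n1' := (b₁.parHi_mem_core hκ h₁.seven_le_gapHi neg_one_mem).1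
  have l1' := (b₁.parLo_mem_core hκ h₁.seven_le_gapLo neg_one_mem).2
  have hz : b₁.tcHi < b₁.parHi hκ h₁.seven_le_gapHi neg_one_mem := by
    rw [← b₁.parHi_zero hκ h₁.seven_le_gapHi]; exact b₁.parHi_lt_parHi hκ h₁.seven_le_gapHi neg_one_mem _ (by norm_num)
  have hz' : b₁.parLo hκ h₁.seven_le_gapLo neg_one_mem < b₁.tcLo := by
    rw [← b₁.parLo_zero hκ h₁.seven_le_gapLo]; exact b₁.parLo_lt_parLo hκ h₁.seven_le_gapLo neg_one_mem _ (by norm_num)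
  exact ⟨cleanP_eq_of_eq h₁ h₂ (cleanH_of_mem h₁ h₂ ⟨by linarith [hs.1], by linarith [hs.2]⟩) u, (cleanQ_foreign_bounds h₁ h₂ hs).1⟩

/-- **Heights on the upper part** `[thi₁, parHi₁ (-1)]`: `≥ 1/2 + κ` and `< 9/10` (`u ∈ [0, 1]`). [folklore] -/
theorem cleanP_one_ge_of_upper {u : ℝ} (hu : u ∈ Icc (0 : ℝ) 1) {s : ℝ} (hs : s ∈ Icc b₁.thi (b₁.parHi h₁.κ_pos h₁.seven_le_gapHi neg_one_mem)) :
    2⁻¹ + κ ≤ cleanP h₁ h₂ u s 1 ∧ cleanP h₁ h₂ u s 1 ≤ 9 / 10 := by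
  have hκ := h₁.κ_pos
  have hκ12 := h₁.κ_le
  have hw := b₁.tcHi_window
  obtain ⟨u1, -⟩ := b₁.thi_marksB
  have n1' := (b₁.parHi_mem_core hκ h₁.seven_le_gapHi neg_one_mem).1
  have n1 := (b₁.parHi_mem_core hκ h₁.seven_le_gapHi neg_one_mem).2
  have hz : s ≤ b₁.parHi hκ h₁.seven_le_gapHi neg_five_quarters_mem :=
    hs.2.trans (b₁.parHi_le_parHi hκ h₁.seven_le_gapHi neg_five_quarters_mem neg_one_mem (by norm_num))
  have hQ := cleanQ_one_mem_of_le h₁ h₂ ⟨hs.1, hz⟩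
  rw [cleanP_apply_one]
  rcases le_or_gt s b₁.tcHi with h | h
  · rw [cleanH_of_le h₁ h₂ h]
    have hH := b₁.hcUp_mem (w := κ) (by linarith) (show b₁.psiInv (b₁.thetaB (17 / 20) + 1) ≤ s by linarith [hs.1])
    constructor
    · nlinarith [mul_nonneg (sub_nonneg.2 hu.2) (sub_nonneg.2 hQ.1), mul_nonneg hu.1 (sub_nonneg.2 hH.1)]
    · nlinarith [mul_nonneg (sub_nonneg.2 hu.2) (sub_nonneg.2 hQ.2.le), mul_nonneg hu.1 (sub_nonneg.2 hH.2.le)]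
  · rw [cleanH_of_mem h₁ h₂ ⟨h, by have := b₁.core_marks; have := b₁.epsLo_bounds.1; linarith [hs.2]⟩]
    constructor <;> nlinarith [hQ.1, hQ.2]

/-- **Heights on the lower part** `[parLo₁ (-1) + 1, tlo₁ + 1]`: `≤ 1/2 - κ` and `> 1/10` (`u ∈ [0, 1]`). [folklore] -/
theorem cleanP_one_le_of_lower {u : ℝ} (hu : u ∈ Icc (0 : ℝ) 1) {s : ℝ} (hs : s ∈ Icc (b₁.parLo h₁.κ_pos h₁.seven_le_gapLo neg_one_mem + 1) (b₁.tlo + 1)) :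
    cleanP h₁ h₂ u s 1 ≤ 2⁻¹ - κ ∧ 10⁻¹ ≤ cleanP h₁ h₂ u s 1 := by
  have hκ := h₁.κ_pos
  have hκ12 := h₁.κ_le
  have hw := b₁.tcLo_window
  have hcm := b₁.core_marks
  have hε' := b₁.epsHi_bounds.1
  obtain ⟨l1, -⟩ := b₁.tlo_marksB
  have c1' := (b₁.parLo_mem_core hκ h₁.seven_le_gapLo neg_one_mem).2
  have c1 := (b₁.parLo_mem_core hκ h₁.seven_le_gapLo neg_one_mem).1
  have hz : b₁.parLo hκ h₁.seven_le_gapLo neg_seven_halves_mem + 1 ≤ s :=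
    le_trans (by linarith [b₁.parLo_le_parLo hκ h₁.seven_le_gapLo neg_seven_halves_mem neg_one_mem (by norm_num)]) hs.1
  have hQ := cleanQ_one_mem_of_ge h₁ h₂ ⟨hz, hs.2⟩
  rw [cleanP_apply_one]
  rcases le_or_gt s (b₁.tcLo + 1) with h | h
  · rw [cleanH_of_mem h₁ h₂ ⟨by linarith [hs.1], h⟩]
    constructor <;> nlinarith [hQ.1, hQ.2]
  · rw [cleanH_of_gt h₁ h₂ h]
    have hH := b₁.hcLo_mem (w := κ) (by linarith) (show s - 1 ≤ b₁.psiInv (b₁.thetaB (3 / 20)) by linarith [hs.2])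
    constructor
    · nlinarith [mul_nonneg (sub_nonneg.2 hu.2) (sub_nonneg.2 hQ.2), mul_nonneg hu.1 (sub_nonneg.2 hH.2)]
    · nlinarith [mul_nonneg (sub_nonneg.2 hu.2) (sub_nonneg.2 hQ.1.le), mul_nonneg hu.1 (sub_nonneg.2 hH.1.le)]

/-- **THE FAMILY STAYS IN THE SQUARE NEIGHBOURHOOD** (`u ∈ [0, 1]`, `s ∈ [thi₁, tlo₁ + 1]`). [folklore] -/
theorem cleanP_mem {u : ℝ} (hu : u ∈ Icc (0 : ℝ) 1) {s : ℝ} (hs : s ∈ Icc b₁.thi (b₁.tlo + 1)) : cleanP h₁ h₂ u s ∈ squareNhd b₁.δ := by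
  have hκ := h₁.κ_pos
  have hκ12 := h₁.κ_le
  have hδ := b₁.δ_pos
  have hw := b₁.tcHi_window
  have hw' := b₁.tcLo_window
  have hcm := b₁.core_marks
  have hε := b₁.epsLo_bounds.1
  have hε' := b₁.epsHi_bounds.1
  have n1' := (b₁.parHi_mem_core hκ h₁.seven_le_gapHi neg_one_mem).1
  have l1' := (b₁.parLo_mem_core hκ h₁.seven_le_gapLo neg_one_mem).2
  -- first coordinate in `[1/2 - 5κ, 1]`, second in `(1/10, 9/10)`
  have h0 : cleanP h₁ h₂ u s 0 ∈ Icc (2⁻¹ - 5 * κ) 1 := by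
    rw [cleanP_apply_zero]
    rcases le_or_gt s (b₁.parHi hκ h₁.seven_le_gapHi neg_one_mem) with h1 | h1
    · rcases le_or_gt s (b₁.thi + b₁.epsHi) with h1' | h1'
      · rw [cleanQ_of_le_edge h₁ h₂ h1', pt2_apply_zero]; constructor <;> nlinarith
      · obtain ⟨e, hm⟩ := cleanP_zero_of_zone2 h₁ h₂ u ⟨h1', h1⟩
        rw [cleanP_apply_zero] at e; rw [e]; exact ⟨by linarith [hm.1], hm.2.le⟩
    rcases lt_or_ge s (b₁.parLo hκ h₁.seven_le_gapLo neg_one_mem + 1) with h2 | h2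
    · have hb := cleanQ_foreign_bounds h₁ h₂ ⟨h1, h2⟩
      exact ⟨hb.2.1, by linarith [hb.1]⟩
    rcases lt_or_ge s (b₁.tlo + 1 - b₁.epsLo) with h3 | h3
    · obtain ⟨e, hm⟩ := cleanP_zero_of_zone4 h₁ h₂ u ⟨h2, h3⟩
      rw [cleanP_apply_zero] at e; rw [e]; exact ⟨by linarith [hm.1], hm.2.le⟩
    · rw [cleanQ_of_ge_edge h₁ h₂ h3, pt2_apply_zero]; constructor <;> nlinarith
  have h1 : cleanP h₁ h₂ u s 1 ∈ Icc (10⁻¹ : ℝ) (9 / 10) := by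
    rcases le_or_gt s (b₁.parHi hκ h₁.seven_le_gapHi neg_one_mem) with h1 | h1
    · have := cleanP_one_ge_of_upper h₁ h₂ hu ⟨hs.1, h1⟩; exact ⟨by linarith [this.1], by linarith [this.2]⟩
    rcases lt_or_ge s (b₁.parLo hκ h₁.seven_le_gapLo neg_one_mem + 1) with h2 | h2
    · obtain ⟨e, -⟩ := cleanP_of_zone3 h₁ h₂ u ⟨h1, h2⟩
      have hb := (cleanQ_foreign_bounds h₁ h₂ ⟨h1, h2⟩).2.2
      rw [e]; rw [abs_le] at hb; exact ⟨by linarith [hb.1], by linarith [hb.2]⟩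
    · have := cleanP_one_le_of_lower h₁ h₂ hu ⟨h2, hs.2⟩; exact ⟨by linarith [this.2], by linarith [this.1]⟩
  rw [mem_squareNhd_iff, Fin.forall_fin_two]
  exact ⟨⟨by linarith [h0.1], by linarith [h0.2]⟩, ⟨by linarith [h1.1], by linarith [h1.2]⟩⟩

/-! ### Injectivity of the loops of the family on the band part -/

/-- `gUp` is strictly decreasing up to `thi₁ + 2 epsHi`. [folklore] -/
theorem strictAntiOn_gUp_edge : StrictAntiOn b₁.gUp (Iic (b₁.thi + 2 * b₁.epsHi)) :=
  strictAntiOn_of_deriv_neg (convex_Iic _) (b₁.gUp_spec.1.continuous.continuousOn) fun _ ht ↦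
    b₁.deriv_gUp_neg (mem_Iic.1 (interior_subset ht))

/-- `gLo` is strictly decreasing from `tlo₁ - 2 epsLo` on. [folklore] -/
theorem strictAntiOn_gLo_edge : StrictAntiOn b₁.gLo (Ici (b₁.tlo - 2 * b₁.epsLo)) :=
  strictAntiOn_of_deriv_neg (convex_Ici _) (b₁.gLo_spec.1.continuous.continuousOn) fun _ ht ↦
    b₁.deriv_gLo_neg (mem_Ici.1 (interior_subset ht))

/-- **The track is injective on the open foreign zone.** [folklore] -/
theorem injOn_cleanQ_foreign : InjOn (cleanQ h₁ h₂) (Ioo (b₁.parHi h₁.κ_pos h₁.seven_le_gapHi neg_one_mem) (b₁.parLo h₁.κ_pos h₁.seven_le_gapLo neg_one_mem + 1)) := by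
  have hκ := h₁.κ_pos
  have hcm := b₁.core_marks
  have z1 := b₁.parHi_le_parHi hκ h₁.seven_le_gapHi neg_one_mem neg_half_mem (by norm_num)
  have z1' := b₁.parHi_le_parHi hκ h₁.seven_le_gapHi neg_one_mem neg_three_quarters_mem (by norm_num)
  have z2 := b₁.parLo_le_parLo hκ h₁.seven_le_gapLo neg_one_mem neg_half_mem (by norm_num)
  have z2' := b₁.parLo_le_parLo hκ h₁.seven_le_gapLo neg_one_mem neg_three_quarters_mem (by norm_num)
  have c1 := (b₁.parHi_mem_core hκ h₁.seven_le_gapHi neg_one_mem).2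
  have c2 := (b₁.parLo_mem_core hκ h₁.seven_le_gapLo neg_one_mem).1
  intro s hs t ht hst
  rw [cleanQ_of_mem h₁ h₂ hs, cleanQ_of_mem h₁ h₂ ht, flipTrack, flipTrack] at hst
  have h1 : b₂.deepTrack hκ h₂.seven_le_gapLo h₂.seven_le_gapHi (theta h₁ h₂ s) = b₂.deepTrack hκ h₂.seven_le_gapLo h₂.seven_le_gapHi (theta h₁ h₂ t) :=
    smul_right_injective _ hκ.ne' (sub_right_injective hst)
  have h2 : theta h₁ h₂ s = theta h₁ h₂ t :=
    b₂.injOn_deepTrack hκ h₂.seven_le_gapLo h₂.seven_le_gapHi (Ioo_subset_Icc_self (theta_mem_Ioo h₁ h₂ s)) (Ioo_subset_Icc_self (theta_mem_Ioo h₁ h₂ t)) h1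
  rw [theta_eq h₁ h₂ ⟨by linarith [hs.1], by linarith [hs.2]⟩, theta_eq h₁ h₂ ⟨by linarith [ht.1], by linarith [ht.2]⟩] at h2
  exact (strictMonoOn_junctionClock b₁ b₂ hκ h₁.seven_le_gapLo h₁.seven_le_gapHi h₂.seven_le_gapLo h₂.seven_le_gapHi).injOn
    ⟨by linarith [hs.1], by linarith [hs.2]⟩ ⟨by linarith [ht.1], by linarith [ht.2]⟩ h2

/-- **THE LOOPS OF THE FAMILY ARE INJECTIVE ON THE BAND PART** `[thi₁ + epsHi/2, tlo₁ + 1 - epsLo/2]`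
(`u ∈ [0, 1]`). [folklore] -/
theorem injOn_cleanP {u : ℝ} (hu : u ∈ Icc (0 : ℝ) 1) :
    InjOn (cleanP h₁ h₂ u) (Icc (b₁.thi + b₁.epsHi / 2) (b₁.tlo + 1 - b₁.epsLo / 2)) := by
  have hκ := h₁.κ_pos
  have hw := b₁.tcHi_window
  have hw' := b₁.tcLo_window
  have hε := b₁.epsLo_bounds.1
  have hε' := b₁.epsHi_bounds.1
  have hcm := b₁.core_marks
  have hm := b₁.marks_lt
  have n1 := (b₁.parHi_mem_core hκ h₁.seven_le_gapHi neg_one_mem).2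
  have n1' := (b₁.parHi_mem_core hκ h₁.seven_le_gapHi neg_one_mem).1
  have l1 := (b₁.parLo_mem_core hκ h₁.seven_le_gapLo neg_one_mem).1
  have l1' := (b₁.parLo_mem_core hκ h₁.seven_le_gapLo neg_one_mem).2
  obtain ⟨u1, u2⟩ := b₁.thi_marksB
  obtain ⟨lo1, lo2⟩ := b₁.tlo_marksB
  set E₁ := b₁.thi + b₁.epsHi with hE₁
  set N₁ := b₁.parHi hκ h₁.seven_le_gapHi neg_one_mem with hN₁
  set L₁ := b₁.parLo hκ h₁.seven_le_gapLo neg_one_mem + 1 with hL₁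
  set E₂ := b₁.tlo + 1 - b₁.epsLo with hE₂
  have hEN : E₁ < N₁ := by linarith
  have hNL : N₁ < L₁ := by linarith
  have hLE : L₁ < E₂ := by linarith
  -- it suffices to treat `s ≤ t`
  suffices key : ∀ s ∈ Icc (b₁.thi + b₁.epsHi / 2) (b₁.tlo + 1 - b₁.epsLo / 2), ∀ t ∈ Icc (b₁.thi + b₁.epsHi / 2) (b₁.tlo + 1 - b₁.epsLo / 2),
      s ≤ t → cleanP h₁ h₂ u s = cleanP h₁ h₂ u t → s = t by
    intro s hs t ht hst
    rcases le_total s t with h | h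
    · exact key s hs t ht h hst
    · exact (key t ht s hs h hst.symm).symm
  intro s hs t ht hst heq
  have hx : cleanP h₁ h₂ u s 0 = cleanP h₁ h₂ u t 0 := by rw [heq]
  have hy : cleanP h₁ h₂ u s 1 = cleanP h₁ h₂ u t 1 := by rw [heq]
  -- heights of `t` in the lower part, of `s` in the upper part
  have yup : ∀ {r}, r ∈ Icc (b₁.thi + b₁.epsHi / 2) N₁ → 2⁻¹ + κ ≤ cleanP h₁ h₂ u r 1 := fun {r} hr ↦
    (cleanP_one_ge_of_upper h₁ h₂ hu ⟨by linarith [hr.1], hr.2⟩).1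
  have ylo : ∀ {r}, r ∈ Icc L₁ (b₁.tlo + 1 - b₁.epsLo / 2) → cleanP h₁ h₂ u r 1 ≤ 2⁻¹ - κ := fun {r} hr ↦
    (cleanP_one_le_of_lower h₁ h₂ hu ⟨hr.1, by linarith [hr.2]⟩).1
  rcases le_or_gt t E₁ with ht1 | ht1
  · -- both in zone 1: `gUp` is injective
    have es := cleanP_of_le_edge h₁ h₂ u (hst.trans ht1)
    have et := cleanP_of_le_edge h₁ h₂ u ht1
    rw [es, et] at hy
    have hy' : b₁.gUp s = b₁.gUp t := hy
    exact (strictAntiOn_gUp_edge (b₁ := b₁)).injOn (show s ∈ Iic _ by simp only [mem_Iic]; linarith) (show t ∈ Iic _ by simp only [mem_Iic]; linarith) hy'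
  rcases le_or_gt s E₁ with hs1 | hs1
  · -- `s` in zone 1 (`x₀ = 1`), `t` beyond: `x₀ t < 1` unless `t` in zone 5, excluded by the heights
    exfalso
    have es := cleanP_of_le_edge h₁ h₂ u hs1
    have hxs : cleanP h₁ h₂ u s 0 = 1 := by rw [es]; rfl
    rcases le_or_gt t N₁ with ht2 | ht2
    · obtain ⟨e, hmm⟩ := cleanP_zero_of_zone2 h₁ h₂ u ⟨ht1, ht2⟩; linarith [hmm.2]
    rcases lt_or_ge t L₁ with ht3 | ht3
    · obtain ⟨e, hlt⟩ := cleanP_of_zone3 h₁ h₂ u ⟨ht2, ht3⟩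
      rw [e] at hx; linarith [h₁.κ_pos]
    rcases lt_or_ge t E₂ with ht4 | ht4
    · obtain ⟨e, hmm⟩ := cleanP_zero_of_zone4 h₁ h₂ u ⟨ht3, ht4⟩; linarith [hmm.2]
    · have et := cleanP_of_ge_edge h₁ h₂ u ht4
      rw [es, et] at hy
      have hy' : b₁.gUp s = b₁.gLo (t - 1) := hy
      have h1 := (b₁.gUp_mem (show b₁.psiInv (b₁.thetaB (17 / 20) + 1) ≤ s by linarith [hs.1])).1
      have h2 := (b₁.gLo_mem (show t - 1 ≤ b₁.psiInv (b₁.thetaB (3 / 20)) by linarith [ht.2])).2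
      linarith
  rcases le_or_gt t N₁ with ht2 | ht2
  · -- both in zone 2: strictly decreasing first coordinate
    obtain ⟨es, -⟩ := cleanP_zero_of_zone2 h₁ h₂ u ⟨hs1, hst.trans ht2⟩
    obtain ⟨et, -⟩ := cleanP_zero_of_zone2 h₁ h₂ u ⟨ht1, ht2⟩
    rw [es, et] at hx
    exact b₁.strictAntiOn_railUp_zero.injOn ⟨hs1.le, by linarith⟩ ⟨ht1.le, by linarith⟩ hx
  rcases le_or_gt s N₁ with hs2 | hs2
  · -- `s` in zone 2 (`x₀ ≥ 1/2 - κ`), `t` beyond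
    exfalso
    obtain ⟨es, hms⟩ := cleanP_zero_of_zone2 h₁ h₂ u ⟨hs1, hs2⟩
    rcases lt_or_ge t L₁ with ht3 | ht3
    · obtain ⟨e, hlt⟩ := cleanP_of_zone3 h₁ h₂ u ⟨ht2, ht3⟩
      rw [e] at hx; rw [es] at hx; linarith [hms.1]
    · -- zone 4 or 5: heights
      have h1 := yup ⟨hs.1, hs2⟩
      have h2 := ylo ⟨ht3, ht.2⟩
      linarith [h₁.κ_pos]
  rcases lt_or_ge t L₁ with ht3 | ht3
  · -- both in zone 3
    obtain ⟨es, -⟩ := cleanP_of_zone3 h₁ h₂ u ⟨hs2, lt_of_le_of_lt hst ht3⟩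
    obtain ⟨et, -⟩ := cleanP_of_zone3 h₁ h₂ u ⟨ht2, ht3⟩
    rw [es, et] at heq
    exact injOn_cleanQ_foreign h₁ h₂ ⟨hs2, lt_of_le_of_lt hst ht3⟩ ⟨ht2, ht3⟩ heq
  rcases lt_or_ge s L₁ with hs3 | hs3
  · -- `s` in zone 3 (`x₀ < 1/2 - κ`), `t` in zone 4 or 5 (`x₀ ≥ 1/2 - κ`)
    exfalso
    obtain ⟨es, hlt⟩ := cleanP_of_zone3 h₁ h₂ u ⟨hs2, hs3⟩
    rw [es] at hx
    rcases lt_or_ge t E₂ with ht4 | ht4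
    · obtain ⟨et, hmt⟩ := cleanP_zero_of_zone4 h₁ h₂ u ⟨ht3, ht4⟩; rw [et] at hx; linarith [hmt.1]
    · have et := cleanP_of_ge_edge h₁ h₂ u ht4
      rw [et] at hx
      have hx' : cleanQ h₁ h₂ s 0 = 1 := hx
      linarith [h₁.κ_pos]
  rcases lt_or_ge t E₂ with ht4 | ht4
  · -- both in zone 4
    obtain ⟨es, -⟩ := cleanP_zero_of_zone4 h₁ h₂ u ⟨hs3, lt_of_le_of_lt hst ht4⟩
    obtain ⟨et, -⟩ := cleanP_zero_of_zone4 h₁ h₂ u ⟨ht3, ht4⟩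
    rw [es, et] at hx
    have := b₁.strictMonoOn_railLo_zero.injOn ⟨by linarith, by linarith⟩ ⟨by linarith, by linarith⟩ hx
    linarith
  rcases lt_or_ge s E₂ with hs4 | hs4
  · -- `s` in zone 4 (`x₀ < 1`), `t` in zone 5 (`x₀ = 1`)
    exfalso
    obtain ⟨es, hms⟩ := cleanP_zero_of_zone4 h₁ h₂ u ⟨hs3, hs4⟩
    have et := cleanP_of_ge_edge h₁ h₂ u ht4
    rw [es, et] at hx
    have hx' : b₁.railLo (s - 1) 0 = 1 := hx
    linarith [hms.2]
  · -- both in zone 5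
    have es := cleanP_of_ge_edge h₁ h₂ u hs4
    have et := cleanP_of_ge_edge h₁ h₂ u ht4
    rw [es, et] at hy
    have hy' : b₁.gLo (s - 1) = b₁.gLo (t - 1) := hy
    have := (strictAntiOn_gLo_edge (b₁ := b₁)).injOn (show s - 1 ∈ Ici _ by simp only [mem_Ici]; linarith)
      (show t - 1 ∈ Ici _ by simp only [mem_Ici]; linarith) hy'
    linarith

/-! ### The band images of the family avoid the second summand -/

/-- **`psi₁` identifies parameters at most one apart modulo one**: for `a, c ∈ [tlo₁ - epsLo, thi₁ + epsHi]`
with `circlePt (psi₁ a) = circlePt (psi₁ c)`, `a = c`. [folklore] -/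
theorem eq_of_circlePt_psi_eq {a c : ℝ} (ha : a ∈ Icc (b₁.tlo - b₁.epsLo) (b₁.thi + b₁.epsHi)) (hc : c ∈ Icc (b₁.tlo - b₁.epsLo) (b₁.thi + b₁.epsHi))
    (h : circlePt (b₁.psi a) = circlePt (b₁.psi c)) : a = c := by
  obtain ⟨m, hm⟩ := circlePt_eq_circlePt_iff.1 h
  have hl := b₁.lam_pos
  obtain ⟨hε, -, hε2⟩ := b₁.epsLo_bounds
  obtain ⟨hε', -, hε2'⟩ := b₁.epsHi_bounds
  have hB := b₁.strictAntiOn_thetaB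
  have h1 : b₁.thetaB (3 / 10) < b₁.thetaB (1 / 5) := hB (by norm_num) (by norm_num) (by norm_num)
  have h2 : b₁.thetaB (4 / 5) < b₁.thetaB (7 / 10) := hB (by norm_num) (by norm_num) (by norm_num)
  have h3 : b₁.thetaB (7 / 10) < b₁.thetaB (3 / 10) := hB (by norm_num) (by norm_num) (by norm_num)
  -- the window of `psi` over `[tlo - epsLo, thi + epsHi]` is shorter than one
  have hwin : b₁.psi (b₁.thi + b₁.epsHi) - b₁.psi (b₁.tlo - b₁.epsLo) < 1 := by
    have e1 : b₁.psi (b₁.thi + b₁.epsHi) = b₁.thetaB (4 / 5) + 1 + b₁.epsHi * b₁.lam := by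
      have := b₁.psi_thi; simp only [psi] at this ⊢; linarith
    have e2 : b₁.psi (b₁.tlo - b₁.epsLo) = b₁.thetaB (1 / 5) - b₁.epsLo * b₁.lam := by simp only [psi]; ring
    rw [e1, e2]; nlinarith
  have hmono := b₁.strictMono_psi.monotone
  have hda : |b₁.psi a - b₁.psi c| < 1 := by
    rw [abs_lt]; constructor
    · linarith [hmono ha.1, hmono hc.2]
    · linarith [hmono ha.2, hmono hc.1]
  rw [hm, add_sub_cancel_left] at hda
  have hm0 : m = 0 := by
    have h1 : (m : ℝ) < 1 := (abs_lt.1 hda).2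
    have h2 : (-1 : ℝ) < m := (abs_lt.1 hda).1
    have h1' : m < 1 := by exact_mod_cast h1
    have h2' : -1 < m := by exact_mod_cast h2
    omega
  rw [hm0, Int.cast_zero, add_zero] at hm
  exact b₁.strictMono_psi.injective hm

include hT in
/-- **THE BAND IMAGES OF THE FAMILY AVOID THE FRAME KNOT OFF THE BAND PART** (`u ∈ [0, 1]`). [folklore] -/
theorem band_cleanP_ne (hA₁ : A₁.InNorth) (hB₁ : B₁.InSouth) (hAB₁ : Disjoint (range A₁) (range B₁)) (hB₂ : B₂.InSouth)
    {u : ℝ} (hu : u ∈ Icc (0 : ℝ) 1) {s : ℝ} (hs : s ∈ Icc (b₁.thi + b₁.epsHi / 2) (b₁.tlo + 1 - b₁.epsLo / 2))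
    {t : ℝ} (ht : t ∈ Ico b₁.tlo (b₁.tlo + 1)) (hts : t ∉ Icc (b₁.thi + b₁.epsHi / 2) (b₁.tlo + 1 - b₁.epsLo / 2)) :
    ((b₁.band (cleanP h₁ h₂ u s) : 𝕊 3) : 𝔼 4) ≠ Knot.curve (frameKnotZero h₁ h₂ hT hA₁ hB₁ hAB₁ hB₂) t := by
  have hκ := h₁.κ_pos
  have hε := b₁.epsLo_bounds.1
  have hε' := b₁.epsHi_bounds.1
  have hm := b₁.marks_lt
  have hw := b₁.tcHi_window
  have hw' := b₁.tcLo_window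
  have hcm := b₁.core_marks
  obtain ⟨u1, u2⟩ := b₁.thi_marksB
  have n1 := (b₁.parHi_mem_core hκ h₁.seven_le_gapHi neg_one_mem).2
  have n1' := (b₁.parHi_mem_core hκ h₁.seven_le_gapHi neg_one_mem).1
  have l1 := (b₁.parLo_mem_core hκ h₁.seven_le_gapLo neg_one_mem).1
  have l1' := (b₁.parLo_mem_core hκ h₁.seven_le_gapLo neg_one_mem).2
  -- the value of the frame knot: a point of `B₁` with parameter `psi t'`, `t' ∉` band part
  obtain ⟨t', ht', hor, ht'e⟩ : ∃ t' ∈ Icc (b₁.tlo - b₁.epsLo) (b₁.thi + b₁.epsHi),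
      ((b₁.tlo ≤ t' ∧ t' < b₁.thi + b₁.epsHi / 2) ∨ b₁.tlo - b₁.epsLo / 2 < t' ∧ t' < b₁.tlo) ∧
      Knot.curve (frameKnotZero h₁ h₂ hT hA₁ hB₁ hAB₁ hB₂) t = ((B₁ (circlePt (b₁.psi t')) : 𝕊 3) : 𝔼 4) := by
    rw [mem_Icc, not_and_or, not_le, not_le] at hts
    rcases hts with h | h
    · refine ⟨t, ⟨by linarith [ht.1], by linarith⟩, Or.inl ⟨ht.1, h⟩, ?_⟩
      rw [Knot.curve_apply, frameKnotZero_circlePt_eq_B h₁ h₂ hT hA₁ hB₁ hAB₁ hB₂ ⟨by linarith [ht.1], by linarith⟩]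
    · refine ⟨t - 1, ⟨by linarith, by linarith [ht.2]⟩, Or.inr ⟨by linarith, by linarith [ht.2]⟩, ?_⟩
      rw [Knot.curve_apply, show circlePt t = circlePt (t - 1) by
        conv_lhs => rw [show t = t - 1 + 1 by ring, circlePt_add_one],
        frameKnotZero_circlePt_eq_B h₁ h₂ hT hA₁ hB₁ hAB₁ hB₂ ⟨by linarith, by linarith [ht.2]⟩]
  rw [ht'e]
  intro he
  have he' : b₁.band (cleanP h₁ h₂ u s) = B₁ (circlePt (b₁.psi t')) := Subtype.ext he
  -- the family point is on the right edge
  have hmem : cleanP h₁ h₂ u s ∈ b₁.band ⁻¹' range B₁ ∩ squareNhd b₁.δ :=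
    ⟨⟨circlePt (b₁.psi t'), he'.symm⟩, cleanP_mem h₁ h₂ hu ⟨by linarith [hs.1], by linarith [hs.2]⟩⟩
  rw [b₁.preimage_right] at hmem
  have hx1 : cleanP h₁ h₂ u s 0 = 1 := hmem.2
  -- hence `s` is in zone 1 or zone 5
  rcases le_or_gt s (b₁.thi + b₁.epsHi) with h1 | h1
  · -- zone 1: the family point is `band (railUp s) = B₁ (psi s)`
    have eP : cleanP h₁ h₂ u s = b₁.railUp s := by rw [cleanP_of_le_edge h₁ h₂ u h1, b₁.railUp_eq_right h1]
    rw [eP, b₁.band_railUp_eq_B ⟨by linarith [hs.1], h1⟩] at he'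
    have := eq_of_circlePt_psi_eq (b₁ := b₁) ⟨by linarith [hs.1], h1⟩ ht' (B₁.injective he')
    rcases hor with h | h
    · linarith [hs.1, h.2]
    · linarith [hs.1, h.2]
  exfalso
  rcases le_or_gt s (b₁.parHi hκ h₁.seven_le_gapHi neg_one_mem) with h2 | h2
  · obtain ⟨e, hmm⟩ := cleanP_zero_of_zone2 h₁ h₂ u ⟨h1, h2⟩; linarith [hmm.2]
  rcases lt_or_ge s (b₁.parLo hκ h₁.seven_le_gapLo neg_one_mem + 1) with h3 | h3
  · obtain ⟨e, hlt⟩ := cleanP_of_zone3 h₁ h₂ u ⟨h2, h3⟩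
    rw [e] at hx1; linarith
  rcases lt_or_ge s (b₁.tlo + 1 - b₁.epsLo) with h4 | h4
  · obtain ⟨e, hmm⟩ := cleanP_zero_of_zone4 h₁ h₂ u ⟨h3, h4⟩; linarith [hmm.2]
  · -- zone 5: the family point is `band (railLo (s - 1)) = B₁ (psi (s - 1))`
    have eP : cleanP h₁ h₂ u s = b₁.railLo (s - 1) := by rw [cleanP_of_ge_edge h₁ h₂ u h4, b₁.railLo_eq_right (by linarith)]
    rw [eP, b₁.band_railLo_eq_B ⟨by linarith, by linarith [hs.2, b₁.tlo_marksB.1]⟩] at he'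
    have := eq_of_circlePt_psi_eq (b₁ := b₁) ⟨by linarith, by linarith [hs.2]⟩ ht' (B₁.injective he')
    rcases hor with h | h
    · linarith [h.1, hs.2]
    · linarith [h.1, hs.2]

/-! ### The planar family and the clean knot -/

include hT in
/-- **THE CLEANING FAMILY IS A PLANAR FAMILY IN THE BAND OF `b₁`.** [folklore] -/
theorem planarFamily_cleanP (hA₁ : A₁.InNorth) (hB₁ : B₁.InSouth) (hAB₁ : Disjoint (range A₁) (range B₁)) (hB₂ : B₂.InSouth) :
    b₁.PlanarFamily (frameKnotZero h₁ h₂ hT hA₁ hB₁ hAB₁ hB₂) b₁.tlo (min b₁.epsLo b₁.epsHi / 4)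
      (b₁.thi + b₁.epsHi / 2) (b₁.thi + b₁.epsHi) (b₁.tlo + 1 - b₁.epsLo) (b₁.tlo + 1 - b₁.epsLo / 2) (cleanP h₁ h₂) := by
  have hε := b₁.epsLo_bounds.1
  have hε' := b₁.epsHi_bounds.1
  have hm := b₁.marks_lt
  have hw := b₁.tcHi_window
  have hw' := b₁.tcLo_window
  have hcm := b₁.core_marks
  have hmin1 : min b₁.epsLo b₁.epsHi ≤ b₁.epsLo := min_le_left _ _
  have hmin2 : min b₁.epsLo b₁.epsHi ≤ b₁.epsHi := min_le_right _ _
  refine ⟨by positivity, ⟨by linarith, by linarith, by linarith, by linarith, by linarith⟩, contDiff_cleanP h₁ h₂,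
    fun u t ht ↦ cleanP_eq_of_not_mem h₁ h₂ u ht, fun s hs ↦ ?_, fun u hu s hs ↦ cleanP_mem h₁ h₂ hu ⟨by linarith [hs.1], by linarith [hs.2]⟩,
    fun u hu s hs ↦ deriv_cleanP_ne_zero h₁ h₂ hu ⟨by linarith [hs.1], by linarith [hs.2]⟩, fun u hu ↦ injOn_cleanP h₁ h₂ hu,
    fun u hu s hs t ht hts ↦ band_cleanP_ne h₁ h₂ hT hA₁ hB₁ hAB₁ hB₂ hu hs ht hts⟩
  rw [cleanP_zero]
  exact curve_frameKnotZero_eq_band h₁ h₂ hT hA₁ hB₁ hAB₁ hB₂ ⟨by linarith [hs.1], by linarith [hs.2]⟩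

/-- **The clean knot**: the end of the cleaning family. [folklore] -/
def cleanKnot (hA₁ : A₁.InNorth) (hB₁ : B₁.InSouth) (hAB₁ : Disjoint (range A₁) (range B₁)) (hB₂ : B₂.InSouth) : Knot :=
  (planarFamily_cleanP h₁ h₂ hT hA₁ hB₁ hAB₁ hB₂).outKnot

/-- **THE FRAME KNOT IS ISOTOPIC TO THE CLEAN KNOT.** [cite: HirschDT1976, Ch. 8 §1, Thm. 1.3] -/
theorem isIsotopic_frameKnotZero_cleanKnot (hA₁ : A₁.InNorth) (hB₁ : B₁.InSouth) (hAB₁ : Disjoint (range A₁) (range B₁)) (hB₂ : B₂.InSouth) :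
    (frameKnotZero h₁ h₂ hT hA₁ hB₁ hAB₁ hB₂).IsIsotopic (cleanKnot h₁ h₂ hT hA₁ hB₁ hAB₁ hB₂) :=
  (planarFamily_cleanP h₁ h₂ hT hA₁ hB₁ hAB₁ hB₂).isIsotopic_outKnot

/-- **The clean knot on the band part** is the band image of the clean track. [folklore] -/
theorem cleanKnot_circlePt_of_mem (hA₁ : A₁.InNorth) (hB₁ : B₁.InSouth) (hAB₁ : Disjoint (range A₁) (range B₁)) (hB₂ : B₂.InSouth)
    {s : ℝ} (hs : s ∈ Icc (b₁.thi + b₁.epsHi / 2) (b₁.tlo + 1 - b₁.epsLo / 2)) :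
    cleanKnot h₁ h₂ hT hA₁ hB₁ hAB₁ hB₂ (circlePt s) = b₁.band (cleanP h₁ h₂ 1 s) :=
  (planarFamily_cleanP h₁ h₂ hT hA₁ hB₁ hAB₁ hB₂).outKnot_circlePt_of_mem hs

/-- **The clean knot off the band part** is the frame knot (a point of `B₁`). [folklore] -/
theorem cleanKnot_circlePt_of_not_mem (hA₁ : A₁.InNorth) (hB₁ : B₁.InSouth) (hAB₁ : Disjoint (range A₁) (range B₁)) (hB₂ : B₂.InSouth)
    {t : ℝ} (ht : t ∈ Ico b₁.tlo (b₁.tlo + 1)) (hts : t ∉ Icc (b₁.thi + b₁.epsHi / 2) (b₁.tlo + 1 - b₁.epsLo / 2)) :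
    cleanKnot h₁ h₂ hT hA₁ hB₁ hAB₁ hB₂ (circlePt t) = frameKnotZero h₁ h₂ hT hA₁ hB₁ hAB₁ hB₂ (circlePt t) :=
  (planarFamily_cleanP h₁ h₂ hT hA₁ hB₁ hAB₁ hB₂).outKnot_circlePt_of_not_mem ht hts

/-- **The clean knot on `[tlo₁, thi₁ + epsHi/2)`** is `B₁ (circlePt (psi₁ t))`. [folklore] -/
theorem cleanKnot_circlePt_eq_B (hA₁ : A₁.InNorth) (hB₁ : B₁.InSouth) (hAB₁ : Disjoint (range A₁) (range B₁)) (hB₂ : B₂.InSouth)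
    {t : ℝ} (ht : t ∈ Ico b₁.tlo (b₁.thi + b₁.epsHi / 2)) :
    cleanKnot h₁ h₂ hT hA₁ hB₁ hAB₁ hB₂ (circlePt t) = B₁ (circlePt (b₁.psi t)) := by
  have hm := b₁.marks_lt
  have hε := b₁.epsLo_bounds.1
  obtain ⟨hε', hε5, -⟩ := b₁.epsHi_bounds
  rw [cleanKnot_circlePt_of_not_mem h₁ h₂ hT hA₁ hB₁ hAB₁ hB₂ ⟨ht.1, by linarith [ht.2]⟩ (fun h ↦ by linarith [h.1, ht.2]),
    frameKnotZero_circlePt_eq_B h₁ h₂ hT hA₁ hB₁ hAB₁ hB₂ ⟨by linarith [ht.1], by linarith [ht.2]⟩]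

end Flip

end BandData

end Literature.Topology.FourManifolds
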